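import Literature.Analysis.FluidPDE.PineauVicolWeightExistence
import Literature.Analysis.FluidPDE.HessianLaplacian
import Literature.Analysis.PDE.HopfMinimumPrinciple
import Literature.Analysis.Hypoelliptic.HormanderProof
import Mathlib.Analysis.Distribution.AEEqOfIntegralContDiff
import Mathlib.MeasureTheory.Integral.IntervalIntegral.FundThmCalculus
import HarnessLib

/-!
# Smoothness and positivity of the weak solution (tools for Pineau–Vicol 2026, Prop. 5.1)

Analysis/FluidPDE support file (all results proved; no named facts), third of four files
realising the positive weight of **Proposition 5.1** of B. Pineau, V. Vicol, arXiv:2607.09619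
(2026):

* **regularity** (`DriftHyp.exists_smooth_solution`): the weak solution of the previous file
  solves `N v := Δ(γv) + div((γv)(½y + U)) = 0` in the sense of distributions; `N` is the
  transpose of a Hörmander operator `Σ Xⱼ² + X₀` with the constant frame `Xⱼ = eⱼ`
  (`hormanderTranspose_frame_eq`, `isBracketGenerating_frame`), so the tree's Hörmander theorem
  (`Literature.Analysis.Hypoelliptic.hormander1967_thm11_proof`) makes `v` smooth, and the
  equation holds classically (`laplacian_add_divergence_eq_zero_of_distributional`);
* the operator `adjN` and its chain rule (`adjN_comp_eq`), the regularised modulus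
  `absApprox δ t = √(t² + δ²)` and the **Kato-type inequality**: `∫ γ ψ_δ''(v)|∇v|² → 0`
  (`DriftHyp.integral_gaussWeight_mul_deriv2_le`), whence `|v|` and `v⁺` are again weak — hence
  smooth — solutions (`DriftHyp.posPart_contDiff`);
* **sign** (`DriftHyp.pos_or_nonpos`, `DriftHyp.exists_pos_solution`, on `ℝⁿ`): a smooth
  nonnegative solution vanishing somewhere vanishes identically by Hopf's strong minimum principle
  (`Literature.Analysis.PDE.hopf_minimumPrinciple`), so `v` has a strict sign and may be taken
  positive.

## References

* B. Pineau, V. Vicol, arXiv:2607.09619 (2026), Prop. 5.1, Lemma 5.5 (positivity). [PineauVicol2026]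
* L. Hörmander, Acta Math. 119 (1967), Thm. 1.1. [Hormander1967]
-/

noncomputable section

open MeasureTheory TopologicalSpace Set Function Filter Topology InnerProductSpace Real
open scoped RealInnerProductSpace ENNReal NNReal ContDiff Distributions

/-! ## F4: regularity of the weak solution (Hörmander) and the classical equation -/

namespace Literature.Analysis.FluidPDE

namespace PineauVicol2026

open Literature.Analysis.Distribution
open scoped Laplacian

variable {E : Type} [NormedAddCommGroup E] [InnerProductSpace ℝ E] [FiniteDimensional ℝ E]
  [MeasurableSpace E] [BorelSpace E]

/-! ### Vector calculus complements -/

omit [FiniteDimensional ℝ E] [MeasurableSpace E] [BorelSpace E] in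
/-- `div (u + w) = div u + div w` at points of differentiability. [folklore] -/
theorem divergence_add_apply {u w : E → E} {x : E} (hu : DifferentiableAt ℝ u x)
    (hw : DifferentiableAt ℝ w x) :
    VectorCalculus.divergence (fun y => u y + w y) x =
      VectorCalculus.divergence u x + VectorCalculus.divergence w x := by
  simp only [VectorCalculus.divergence]
  rw [fderiv_fun_add hu hw, ContinuousLinearMap.toLinearMap_add, map_add]

omit [MeasurableSpace E] [BorelSpace E] in
/-- `div (∇φ) = Δφ` for `C²` functions. [folklore] -/
theorem divergence_gradient {φ : E → ℝ} (hφ : ContDiff ℝ 2 φ) (x : E) :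
    VectorCalculus.divergence (gradient φ) x = (Δ φ) x := by
  haveI : CompleteSpace E := FiniteDimensional.complete ℝ E
  set b := stdOrthonormalBasis ℝ E
  rw [divergence_eq_sum_inner_fderiv b, laplacian_eq_sum_fderiv_fderiv b hφ]
  refine Finset.sum_congr rfl fun i _ => ?_
  have hd : DifferentiableAt ℝ (fderiv ℝ φ) x :=
    ((hφ.fderiv_right (m := 1) le_rfl).differentiable one_ne_zero) x
  have e1 : gradient φ = (toDual ℝ E).symm.toContinuousLinearEquiv ∘ fderiv ℝ φ := rfl
  rw [e1, ContinuousLinearEquiv.comp_fderiv, fderiv_clm_apply hd (differentiableAt_const _)]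
  simp only [ContinuousLinearMap.coe_comp, ContinuousLinearEquiv.coe_coe, Function.comp_apply,
    LinearIsometryEquiv.coe_toContinuousLinearEquiv, fderiv_fun_const, Pi.zero_apply,
    ContinuousLinearMap.comp_zero, zero_add, ContinuousLinearMap.flip_apply]
  rw [real_inner_comm, InnerProductSpace.toDual_symm_apply]

omit [MeasurableSpace E] [BorelSpace E] in
/-- The gradient of a `C^{n+1}` function is `Cⁿ`. [folklore] -/
theorem contDiff_gradient {φ : E → ℝ} {n : ℕ∞} (hφ : ContDiff ℝ (n + 1) φ) : ContDiff ℝ n (gradient φ) := by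
  haveI : CompleteSpace E := FiniteDimensional.complete ℝ E
  have e1 : gradient φ = fun y => (toDual ℝ E).symm (fderiv ℝ φ y) := rfl
  rw [e1]
  exact (toDual ℝ E).symm.toContinuousLinearEquiv.contDiff.comp (hφ.fderiv_right le_rfl)

omit [InnerProductSpace ℝ E] [FiniteDimensional ℝ E] [MeasurableSpace E] [BorelSpace E] in
/-- A continuous compactly supported function is bounded. [folklore] -/
theorem exists_bound_of_hasCompactSupport {F : Type*} [NormedAddCommGroup F] {g : E → F}
    (hg : Continuous g) (hc : HasCompactSupport g) : ∃ C, ∀ x, ‖g x‖ ≤ C :=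
  hg.bounded_above_of_compact_support hc

/-! ### Integrability against the weight -/

/-- `γ f` is integrable for `f ∈ L²(γ)`. [folklore] -/
theorem integrable_gaussWeight_mul_of_memLp {f : E → ℝ} (hf : MemLp f 2 (gaussMeasure (E := E))) :
    Integrable (fun y => gaussWeight y * f y) := by
  have h1 : Integrable f (gaussMeasure (E := E)) := hf.integrable one_le_two
  rw [integrable_gaussMeasure_iff] at h1
  simpa only [smul_eq_mul] using h1

/-- `γ f g` is integrable for `f ∈ L²(γ)` and `g` bounded continuous. [folklore] -/
theorem integrable_gaussWeight_mul_mul_of_bound {f g : E → ℝ} (hf : MemLp f 2 (gaussMeasure (E := E)))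
    (hg : Continuous g) {C : ℝ} (hC : ∀ y, ‖g y‖ ≤ C) :
    Integrable (fun y => gaussWeight y * f y * g y) :=
  (integrable_gaussWeight_mul_of_memLp hf).mul_bdd hg.aestronglyMeasurable (Eventually.of_forall hC)

omit [InnerProductSpace ℝ E] [FiniteDimensional ℝ E] [MeasurableSpace E] [BorelSpace E] in
/-- A function vanishing off the topological support of a compactly supported one has compact
support. [folklore] -/
theorem hasCompactSupport_of_eq_zero {F F' : Type*} [Zero F] [Zero F'] [TopologicalSpace F]
    {g : E → F} {k : E → F'} (hg : HasCompactSupport g) (hk : ∀ y, y ∉ tsupport g → k y = 0) :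
    HasCompactSupport k :=
  HasCompactSupport.intro hg hk

omit [MeasurableSpace E] [BorelSpace E] in
/-- The Laplacian of a compactly supported function has compact support. [folklore] -/
theorem hasCompactSupport_laplacian {φ : E → ℝ} (hc : HasCompactSupport φ) : HasCompactSupport (Δ φ) :=
  hasCompactSupport_of_eq_zero hc fun _ hy => laplacian_eq_zero_of_notMem_tsupport hy

/-! ### From the weak formulation to the distributional equation -/

/-- **The distributional equation.** If `f ∈ L²(γ)` has the `γ`-weak gradient `G` and the pair
satisfies the weak equation `∫γ⟪G,∇φ⟫ − ∫γ⟪U,G⟫φ + ∫γ ½⟪U,y⟫ f φ = 0`, then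
`∫ (γ f) (Δφ − Dφ[½y + U]) dy = 0` for every test function `φ`: `u = γ f` is a distributional
solution of `Δu + div(u (½y + U)) = 0`, i.e. of `L*u = 0` ((5.1)–(5.2)). [cite: PineauVicol2026, (5.1)–(5.2) and Remark 5.2] -/
theorem DriftHyp.integral_mul_transpose_eq_zero {U : E → E} {C₀ : ℝ} (h : DriftHyp U C₀)
    {f : E → ℝ} {G : E → E} (hf : MemLp f 2 (gaussMeasure (E := E)))
    (hgrad : ∀ (Ψ : E → E) (C : ℝ), ContDiff ℝ 1 Ψ → (∀ y, ‖Ψ y‖ ≤ C) →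
      (∀ y, |VectorCalculus.divergence Ψ y| ≤ C) →
        ∫ y, gaussWeight y * ⟪G y, Ψ y⟫ =
          -∫ y, gaussWeight y * (f y * (VectorCalculus.divergence Ψ y - ⟪Ψ y, y⟫ / 2)))
    (hweak : ∀ φ : E → ℝ, ContDiff ℝ ∞ φ → HasCompactSupport φ →
      (∫ y, gaussWeight y * ⟪G y, gradient φ y⟫) - (∫ y, gaussWeight y * (⟪U y, G y⟫ * φ y)) +
        (∫ y, gaussWeight y * (⟪U y, y⟫ / 2 * f y * φ y)) = 0)
    (φ : E → ℝ) (hφ : ContDiff ℝ ∞ φ) (hφc : HasCompactSupport φ) :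
    ∫ y, (gaussWeight y * f y) * ((Δ φ) y - fderiv ℝ φ y ((1 / 2 : ℝ) • y + U y)) = 0 := by
  have hφ2 : ContDiff ℝ 2 φ := hφ.of_le (by norm_cast)
  have hφ1 : ContDiff ℝ 1 φ := hφ.of_le (by norm_cast)
  have hgφ : ContDiff ℝ 1 (gradient φ) := contDiff_gradient (n := 1) (hφ.of_le (by norm_cast))
  have hgc : HasCompactSupport (gradient φ) := hasCompactSupport_gradient hφc
  obtain ⟨C₁, hC₁⟩ := exists_bound_of_hasCompactSupport hgφ.continuous hgc
  have hΔc : Continuous (Δ φ) := continuous_laplacian hφ2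
  obtain ⟨C₂, hC₂⟩ := exists_bound_of_hasCompactSupport hΔc (hasCompactSupport_laplacian hφc)
  obtain ⟨C₃, hC₃⟩ := exists_bound_of_hasCompactSupport hφ.continuous hφc
  have hC₃0 : 0 ≤ C₃ := (norm_nonneg _).trans (hC₃ 0)
  have hC₀ := h.nonneg
  -- `Ψ₁ = ∇φ`
  have hdiv1 : ∀ y, VectorCalculus.divergence (gradient φ) y = (Δ φ) y := divergence_gradient hφ2
  have e1 := hgrad (gradient φ) (max C₁ C₂) hgφ (fun y => (hC₁ y).trans (le_max_left _ _))
    (fun y => by rw [hdiv1, ← Real.norm_eq_abs]; exact (hC₂ y).trans (le_max_right _ _))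
  -- `Ψ₂ = φ U`
  have hΨ2 : ContDiff ℝ 1 (fun y => φ y • U y) := hφ1.smul h.contDiff_one
  have hdiv2 : ∀ y, VectorCalculus.divergence (fun y => φ y • U y) y = ⟪U y, gradient φ y⟫ := by
    intro y
    rw [divergence_smul_apply (hφ1.differentiable one_ne_zero y)
      (h.contDiff_one.differentiable one_ne_zero y), h.div_eq_zero, mul_zero, zero_add]
  have hb2 : ∀ y, ‖φ y • U y‖ ≤ C₃ * C₀ := fun y => by
    rw [norm_smul]; exact mul_le_mul (hC₃ y) (h.norm_le y) (norm_nonneg _) hC₃0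
  have hdb2 : ∀ y, |VectorCalculus.divergence (fun y => φ y • U y) y| ≤ C₀ * C₁ := fun y => by
    rw [hdiv2]
    exact (abs_real_inner_le_norm _ _).trans (mul_le_mul (h.norm_le y) (hC₁ y) (norm_nonneg _) hC₀)
  have e2 := hgrad (fun y => φ y • U y) (max (C₃ * C₀) (C₀ * C₁)) hΨ2
    (fun y => (hb2 y).trans (le_max_left _ _)) (fun y => (hdb2 y).trans (le_max_right _ _))
  have e3 := hweak φ hφ hφc
  have r1 : ∫ y, gaussWeight y * (⟪U y, G y⟫ * φ y) = ∫ y, gaussWeight y * ⟪G y, φ y • U y⟫ := by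
    refine integral_congr_ae (Eventually.of_forall fun y => ?_)
    dsimp only
    rw [real_inner_smul_right, real_inner_comm]
    ring
  rw [r1, e1, e2] at e3
  simp only [hdiv1, hdiv2] at e3
  -- the three bounded compactly supported multipliers
  set g₁ : E → ℝ := fun y => (Δ φ) y - ⟪gradient φ y, y⟫ / 2 with hg₁
  set g₂ : E → ℝ := fun y => ⟪U y, gradient φ y⟫ - ⟪φ y • U y, y⟫ / 2 with hg₂
  set g₃ : E → ℝ := fun y => ⟪U y, y⟫ / 2 * φ y with hg₃
  have hg₁c : Continuous g₁ := hΔc.sub ((hgφ.continuous.inner continuous_id).div_const 2)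
  have hg₂c : Continuous g₂ := (h.continuous.inner hgφ.continuous).sub
    (((hφ.continuous.smul h.continuous).inner continuous_id).div_const 2)
  have hg₃c : Continuous g₃ := ((h.continuous.inner continuous_id).div_const 2).mul hφ.continuous
  have hg₁s : HasCompactSupport g₁ := by
    refine hasCompactSupport_of_eq_zero hφc fun y hy => ?_
    simp only [hg₁, laplacian_eq_zero_of_notMem_tsupport hy, gradient_eq_zero_of_notMem_tsupport hy,
      inner_zero_left, zero_div, sub_zero]
  have hg₂s : HasCompactSupport g₂ := by
    refine hasCompactSupport_of_eq_zero hφc fun y hy => ?_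
    simp only [hg₂, gradient_eq_zero_of_notMem_tsupport hy, image_eq_zero_of_notMem_tsupport hy,
      inner_zero_right, zero_smul, inner_zero_left, zero_div, sub_zero]
  have hg₃s : HasCompactSupport g₃ := by
    refine hasCompactSupport_of_eq_zero hφc fun y hy => ?_
    simp only [hg₃, image_eq_zero_of_notMem_tsupport hy, mul_zero]
  obtain ⟨K₁, hK₁⟩ := exists_bound_of_hasCompactSupport hg₁c hg₁s
  obtain ⟨K₂, hK₂⟩ := exists_bound_of_hasCompactSupport hg₂c hg₂s
  obtain ⟨K₃, hK₃⟩ := exists_bound_of_hasCompactSupport hg₃c hg₃s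
  have i1 := integrable_gaussWeight_mul_mul_of_bound hf hg₁c hK₁
  have i2 := integrable_gaussWeight_mul_mul_of_bound hf hg₂c hK₂
  have i3 := integrable_gaussWeight_mul_mul_of_bound hf hg₃c hK₃
  -- rewrite `e3` with the multipliers
  have s1 : ∫ y, gaussWeight y * (f y * ((Δ φ) y - ⟪gradient φ y, y⟫ / 2)) = ∫ y, gaussWeight y * f y * g₁ y :=
    integral_congr_ae (Eventually.of_forall fun y => by simp only [hg₁]; ring)
  have s2 : ∫ y, gaussWeight y * (f y * (⟪U y, gradient φ y⟫ - ⟪φ y • U y, y⟫ / 2)) =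
      ∫ y, gaussWeight y * f y * g₂ y :=
    integral_congr_ae (Eventually.of_forall fun y => by simp only [hg₂]; ring)
  have s3 : ∫ y, gaussWeight y * (⟪U y, y⟫ / 2 * f y * φ y) = ∫ y, gaussWeight y * f y * g₃ y :=
    integral_congr_ae (Eventually.of_forall fun y => by simp only [hg₃]; ring)
  rw [s1, s2, s3] at e3
  -- the target integrand is `γ f (g₁ − g₂ − g₃)`
  have st : ∫ y, (gaussWeight y * f y) * ((Δ φ) y - fderiv ℝ φ y ((1 / 2 : ℝ) • y + U y)) =
      ∫ y, (gaussWeight y * f y * g₁ y - gaussWeight y * f y * g₂ y) - gaussWeight y * f y * g₃ y := by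
    refine integral_congr_ae (Eventually.of_forall fun y => ?_)
    simp only [hg₁, hg₂, hg₃]
    rw [← inner_gradient_left, inner_add_right, real_inner_smul_right, real_inner_smul_left,
      real_inner_comm (U y)]
    ring
  have i12 : Integrable (fun y => gaussWeight y * f y * g₁ y - gaussWeight y * f y * g₂ y) := i1.sub i2
  rw [st, integral_sub i12 i3, integral_sub i1 i2]
  linarith

/-! ### Regularity: Hörmander's theorem for `Δ + (½y + U)·∇ + div(½y + U)` -/

omit [MeasurableSpace E] [BorelSpace E] in
/-- The transposed Hörmander operator of `P = Σⱼ ∂ⱼ² + X₀ + div X₀` (constant frame fields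
`Xⱼ = bⱼ`) on `C²` functions is `ᵗP φ = Δφ − Dφ[X₀]`. [folklore] -/
theorem hormanderTranspose_frame_eq {ι : Type*} [Fintype ι] (b : OrthonormalBasis ι ℝ E)
    {X₀ : E → E} {φ : E → ℝ} (hφ : ContDiff ℝ 2 φ) (x : E) :
    hormanderTranspose X₀ (fun j (_ : E) => b j) (fieldDiv X₀) φ x = (Δ φ) x - fderiv ℝ φ x (X₀ x) := by
  have hinner : ∀ j, fieldTranspose (fun _ : E => b j) φ = fun y => -fderiv ℝ φ y (b j) := by
    intro j; funext y
    simp [fieldTranspose, fieldDeriv, fieldDiv]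
  have hsum : ∀ j, fieldTranspose (fun _ : E => b j) (fieldTranspose (fun _ : E => b j) φ) x =
      fderiv ℝ (fun y => fderiv ℝ φ y (b j)) x (b j) := by
    intro j
    rw [hinner j]
    simp only [fieldTranspose, fieldDeriv, fieldDiv, fderiv_fun_const, Pi.zero_apply,
      ContinuousLinearMap.toLinearMap_zero, map_zero, zero_mul, sub_zero]
    rw [fderiv_fun_neg, neg_apply, neg_neg]
  simp only [hormanderTranspose, hsum, laplacian_eq_sum_fderiv_fderiv b hφ x]
  simp only [fieldTranspose, fieldDeriv]
  ring

omit [FiniteDimensional ℝ E] [MeasurableSpace E] [BorelSpace E] in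
/-- A frame of constant fields is bracket generating (already at step zero). [folklore] -/
theorem isBracketGenerating_frame {ι : Type*} [Fintype ι] (b : OrthonormalBasis ι ℝ E) (X₀ : E → E)
    (s : Set E) : IsBracketGenerating (fun o : Option ι => o.elim X₀ (fun j (_ : E) => b j)) s := by
  intro x _
  rw [eq_top_iff]
  have hmem : ∀ j, b j ∈ {v : E | ∃ V : E → E,
      IsIteratedLieBracket (fun o : Option ι => o.elim X₀ (fun j (_ : E) => b j)) V ∧ V x = v} :=
    fun j => ⟨fun _ => b j, IsIteratedLieBracket.of (some j), rfl⟩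
  calc (⊤ : Submodule ℝ E) = Submodule.span ℝ (Set.range b) := by
        rw [← OrthonormalBasis.coe_toBasis, b.toBasis.span_eq]
    _ ≤ _ := Submodule.span_mono (Set.range_subset_iff.2 hmem)

/-- **Interior regularity** (Hörmander 1967, Thm. 1.1, through the tree's
`Literature.Analysis.Hypoelliptic.hormander1967_thm11_proof`; for this elliptic operator also
Folland 1995, Cor. 6.34): a locally integrable distributional solution `u` of
`Δu + div(u(½y + U)) = 0` — `∫ u (Δφ − Dφ[½y + U]) = 0` for all test functions — agrees a.e. with a
smooth function. [cite: Hormander1967, Thm 1.1] -/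
theorem DriftHyp.exists_contDiff_ae_eq {U : E → E} {C₀ : ℝ} (h : DriftHyp U C₀) {u : E → ℝ}
    (hu : LocallyIntegrable u volume)
    (hdist : ∀ φ : E → ℝ, ContDiff ℝ ∞ φ → HasCompactSupport φ →
      ∫ y, u y * ((Δ φ) y - fderiv ℝ φ y ((1 / 2 : ℝ) • y + U y)) = 0) :
    ∃ w : E → ℝ, ContDiff ℝ ∞ w ∧ u =ᵐ[volume] w := by
  set X₀ : E → E := fun y => (1 / 2 : ℝ) • y + U y with hX₀def
  have hX₀ : ContDiff ℝ ∞ X₀ := (contDiff_id.const_smul (1 / 2 : ℝ)).add h.contDiff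
  set b := stdOrthonormalBasis ℝ E with hb
  set X : Fin (Module.finrank ℝ E) → E → E := fun j _ => b j with hX
  set c : E → ℝ := fieldDiv X₀ with hcdef
  have hc : ContDiff ℝ ∞ c := contDiff_fieldDiv hX₀
  have hhyp : IsHypoellipticOn (⊤ : Opens E) (hormanderTranspose X₀ X c) volume :=
    Literature.Analysis.Hypoelliptic.hormander1967_thm11_proof E volume (Fin (Module.finrank ℝ E)) ⊤ X₀ X c
      hX₀ (fun _ => contDiff_const) hc (isBracketGenerating_frame b X₀ _)
  -- the distribution `u dy`
  have huU : LocallyIntegrableOn u ((⊤ : Opens E) : Set E) volume := hu.locallyIntegrableOn _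
  let uD : 𝓓'((⊤ : Opens E), ℝ) :=
    (TestFunction.integralAgainstBilinCLM (ContinuousLinearMap.mul ℝ ℝ) volume u : 𝓓((⊤ : Opens E), ℝ) →L[ℝ] ℝ)
  have huD : ∀ φ : 𝓓((⊤ : Opens E), ℝ), uD φ = ∫ x, φ x * u x := by
    intro φ
    change TestFunction.integralAgainstBilinCLM (ContinuousLinearMap.mul ℝ ℝ) volume u φ = _
    rw [TestFunction.integralAgainstBilinCLM_eq_integral huU]
    simp
  have himg : Distribution.ImageIsSmoothOn uD (hormanderTranspose X₀ X c) volume Set.univ := by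
    refine ⟨fun _ => 0, contDiffOn_const, fun φ ψ _ hψ => ?_⟩
    rw [huD ψ]
    simp only [zero_mul, integral_zero]
    have hφ2 : ContDiff ℝ 2 (φ : E → ℝ) := φ.contDiff.of_le (by norm_cast)
    calc ∫ x, ψ x * u x = ∫ y, u y * ((Δ (φ : E → ℝ)) y - fderiv ℝ (φ : E → ℝ) y ((1 / 2 : ℝ) • y + U y)) := by
          refine integral_congr_ae (Eventually.of_forall fun y => ?_)
          dsimp only
          rw [hψ, hX, hcdef, hormanderTranspose_frame_eq b hφ2 y, mul_comm]
      _ = 0 := hdist φ φ.contDiff φ.hasCompactSupport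
  obtain ⟨w, hw, hwint⟩ := hhyp uD Set.univ isOpen_univ (fun _ _ => trivial) himg
  refine ⟨w, contDiffOn_univ.1 hw, ?_⟩
  have hwli : LocallyIntegrable w volume := (contDiffOn_univ.1 hw).continuous.locallyIntegrable
  refine ae_eq_of_integral_contDiff_smul_eq hu hwli fun g hg hgc => ?_
  have h1 := hwint (mkTest g hg hgc) (Set.subset_univ _)
  rw [huD] at h1
  simp only [coe_mkTest] at h1
  simp only [smul_eq_mul]
  rw [h1]
  exact integral_congr_ae (Eventually.of_forall fun x => mul_comm _ _)

/-! ### From the distributional to the classical equation for smooth solutions -/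

/-- **Transposition on test functions**: for `w ∈ C²`, `X₀ ∈ C¹` and a test function `φ`,
`∫ w (Δφ − Dφ[X₀]) = ∫ (Δw + div(w X₀)) φ` (Green's identity twice and one divergence
integration by parts, all boundary-free). [folklore] -/
theorem integral_mul_transpose_eq {w : E → ℝ} {X₀ : E → E} (hw : ContDiff ℝ 2 w) (hX₀ : ContDiff ℝ 1 X₀)
    {φ : E → ℝ} (hφ : ContDiff ℝ ∞ φ) (hφc : HasCompactSupport φ) :
    ∫ y, w y * ((Δ φ) y - fderiv ℝ φ y (X₀ y)) =
      ∫ y, ((Δ w) y + VectorCalculus.divergence (fun z => w z • X₀ z) y) * φ y := by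
  set b := stdOrthonormalBasis ℝ E with hb
  have hφ2 : ContDiff ℝ 2 φ := hφ.of_le (by norm_cast)
  have hφ1 : ContDiff ℝ 1 φ := hφ.of_le (by norm_cast)
  have hw1 : ContDiff ℝ 1 w := hw.of_le (by norm_cast)
  -- Green twice: `∫ w Δφ = ∫ (Δw) φ`
  have g1 := integral_inner_laplacian_add_eq_zero b hφ2 hw1 (Or.inl hφc)
  have g2 := integral_inner_laplacian_add_eq_zero b hw hφ1 (Or.inr hφc)
  have hsum : ∑ i, ∫ x, ⟪fderiv ℝ φ x (b i), fderiv ℝ w x (b i)⟫ =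
      ∑ i, ∫ x, ⟪fderiv ℝ w x (b i), fderiv ℝ φ x (b i)⟫ := by
    refine Finset.sum_congr rfl fun i _ => integral_congr_ae (Eventually.of_forall fun x => ?_)
    exact real_inner_comm _ _
  have hlap : ∫ x, w x * (Δ φ) x = ∫ x, (Δ w) x * φ x := by
    have e1 : ∫ x, ⟪(Δ φ) x, w x⟫ = ∫ x, w x * (Δ φ) x :=
      integral_congr_ae (Eventually.of_forall fun x => by simp only [RCLike.inner_apply, conj_trivial])
    have e2 : ∫ x, ⟪(Δ w) x, φ x⟫ = ∫ x, (Δ w) x * φ x :=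
      integral_congr_ae (Eventually.of_forall fun x => by
        simp only [RCLike.inner_apply, conj_trivial]; ring)
    rw [← e1, ← e2]
    linarith
  -- drift: `∫ w Dφ[X₀] = -∫ φ div(w X₀)`
  have hd := integral_mul_divergence_add_eq_zero_left (u := fun z => w z • X₀ z) hφ1 (hw1.smul hX₀) hφc
  have e3 : ∫ x, ⟪w x • X₀ x, gradient φ x⟫ = ∫ x, w x * fderiv ℝ φ x (X₀ x) :=
    integral_congr_ae (Eventually.of_forall fun x => by
      dsimp only
      rw [real_inner_smul_left, real_inner_comm, inner_gradient_left])
  rw [e3] at hd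
  -- integrability (compact support of `φ`)
  have hΔφs := hasCompactSupport_laplacian hφc
  have i1 : Integrable (fun y => w y * (Δ φ) y) :=
    (hw.continuous.mul (continuous_laplacian hφ2)).integrable_of_hasCompactSupport hΔφs.mul_left
  have i2 : Integrable (fun y => w y * fderiv ℝ φ y (X₀ y)) := by
    refine (hw.continuous.mul ((hφ.continuous_fderiv (by simp)).clm_apply hX₀.continuous)).integrable_of_hasCompactSupport ?_
    refine (hasCompactSupport_of_eq_zero hφc fun y hy => ?_).mul_left
    rw [fderiv_of_notMem_tsupport ℝ hy, zero_apply]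
  have i3 : Integrable (fun y => (Δ w) y * φ y) :=
    ((continuous_laplacian hw).mul hφ.continuous).integrable_of_hasCompactSupport hφc.mul_left
  have i4 : Integrable (fun y => VectorCalculus.divergence (fun z => w z • X₀ z) y * φ y) :=
    ((continuous_divergence ((hw1.smul hX₀).continuous_fderiv one_ne_zero)).mul hφ.continuous)
      |>.integrable_of_hasCompactSupport hφc.mul_left
  have lhs : ∫ y, w y * ((Δ φ) y - fderiv ℝ φ y (X₀ y)) =
      (∫ y, w y * (Δ φ) y) - ∫ y, w y * fderiv ℝ φ y (X₀ y) := by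
    rw [← integral_sub i1 i2]
    exact integral_congr_ae (Eventually.of_forall fun y => by ring)
  have rhs : ∫ y, ((Δ w) y + VectorCalculus.divergence (fun z => w z • X₀ z) y) * φ y =
      (∫ y, (Δ w) y * φ y) + ∫ y, VectorCalculus.divergence (fun z => w z • X₀ z) y * φ y := by
    rw [← integral_add i3 i4]
    exact integral_congr_ae (Eventually.of_forall fun y => by ring)
  have e4 : ∫ y, φ y * VectorCalculus.divergence (fun z => w z • X₀ z) y =
      ∫ y, VectorCalculus.divergence (fun z => w z • X₀ z) y * φ y :=
    integral_congr_ae (Eventually.of_forall fun y => mul_comm _ _)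
  rw [lhs, rhs, hlap, ← e4]
  linarith

omit [InnerProductSpace ℝ E] in
/-- A continuous function orthogonal to all test functions vanishes identically. [folklore] -/
theorem eq_zero_of_forall_integral_mul_eq_zero [NormedSpace ℝ E] [FiniteDimensional ℝ E] {g : E → ℝ}
    (hg : Continuous g) {μ : Measure E} [μ.IsAddHaarMeasure]
    (h : ∀ φ : E → ℝ, ContDiff ℝ ∞ φ → HasCompactSupport φ → ∫ y, g y * φ y ∂μ = 0) : g = 0 := by
  have hae := ae_eq_zero_of_integral_contDiff_smul_eq_zero hg.locallyIntegrable fun φ hφ hφc => by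
    simp only [smul_eq_mul]
    rw [← h φ hφ hφc]
    exact integral_congr_ae (Eventually.of_forall fun y => mul_comm _ _)
  exact (hg.ae_eq_iff_eq μ continuous_const).1 hae

/-- **Classical equation from the distributional one** for a smooth `w`:
`∫ w (Δφ − Dφ[X₀]) = 0` for all test `φ` gives `Δw + div(w X₀) = 0` pointwise. [folklore] -/
theorem laplacian_add_divergence_eq_zero_of_distributional {w : E → ℝ} {X₀ : E → E}
    (hw : ContDiff ℝ ∞ w) (hX₀ : ContDiff ℝ ∞ X₀)
    (hdist : ∀ φ : E → ℝ, ContDiff ℝ ∞ φ → HasCompactSupport φ →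
      ∫ y, w y * ((Δ φ) y - fderiv ℝ φ y (X₀ y)) = 0) (y : E) :
    (Δ w) y + VectorCalculus.divergence (fun z => w z • X₀ z) y = 0 := by
  have hw2 : ContDiff ℝ 2 w := hw.of_le (by norm_cast)
  have hX1 : ContDiff ℝ 1 X₀ := hX₀.of_le (by norm_cast)
  have hcont : Continuous fun y => (Δ w) y + VectorCalculus.divergence (fun z => w z • X₀ z) y :=
    (continuous_laplacian hw2).add
      (continuous_divergence (((hw.of_le (by norm_cast)).smul hX1).continuous_fderiv one_ne_zero))
  have := eq_zero_of_forall_integral_mul_eq_zero hcont (μ := volume) fun φ hφ hφc => by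
    rw [← integral_mul_transpose_eq hw2 hX1 hφ hφc]
    exact hdist φ hφ hφc
  exact congrFun this y

/-! ### Identification of the weak gradient with the classical one -/

/-- `γ G` is integrable for `G ∈ L²(γ; E)`. [folklore] -/
theorem integrable_gaussWeight_smul_of_memLp {G : E → E} (hG : MemLp G 2 (gaussMeasure (E := E))) :
    Integrable (fun y => gaussWeight y • G y) := by
  have h1 : Integrable G (gaussMeasure (E := E)) := hG.integrable one_le_two
  rwa [integrable_gaussMeasure_iff] at h1

/-- The test-field step of the identification of the weak gradient: for `Ψ = g e` with a test
function `g` and a unit vector `e`, `∫ g γ ⟪∇v − G, e⟫ = 0`. [folklore] -/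
theorem integral_smul_gaussWeight_mul_inner_sub_eq_zero {v f : E → ℝ} {G : E → E} (hv : ContDiff ℝ 1 v)
    (hfv : f =ᵐ[volume] v) (hG : MemLp G 2 (gaussMeasure (E := E)))
    (hgrad : ∀ (Ψ : E → E) (C : ℝ), ContDiff ℝ 1 Ψ → (∀ y, ‖Ψ y‖ ≤ C) →
      (∀ y, |VectorCalculus.divergence Ψ y| ≤ C) →
        ∫ y, gaussWeight y * ⟪G y, Ψ y⟫ =
          -∫ y, gaussWeight y * (f y * (VectorCalculus.divergence Ψ y - ⟪Ψ y, y⟫ / 2)))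
    {e : E} (he : ‖e‖ = 1) {g : E → ℝ} (hg : ContDiff ℝ ∞ g) (hgc : HasCompactSupport g) :
    ∫ y, g y • (gaussWeight y * ⟪gradient v y - G y, e⟫) = 0 := by
  haveI : CompleteSpace E := FiniteDimensional.complete ℝ E
  have hgvc : Continuous (gradient v) := continuous_gradient_of_contDiff hv
  have hγG := integrable_gaussWeight_smul_of_memLp hG
  have hg1 : ContDiff ℝ 1 g := hg.of_le (by norm_cast)
  have hΨ : ContDiff ℝ 1 (fun y => g y • e) := hg1.smul contDiff_const
  have hΨc : HasCompactSupport (fun y => g y • e) := hgc.smul_right (f' := fun _ : E => e)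
  have hgg : Continuous (gradient g) := continuous_gradient_of_contDiff hg1
  obtain ⟨Cg, hCg⟩ := exists_bound_of_hasCompactSupport hg.continuous hgc
  obtain ⟨Cd, hCd⟩ := exists_bound_of_hasCompactSupport hgg (hasCompactSupport_gradient hgc)
  have hdivΨ : ∀ y, VectorCalculus.divergence (fun y => g y • e) y = ⟪e, gradient g y⟫ := by
    intro y
    rw [divergence_smul_apply (u := fun _ : E => e) (hg1.differentiable one_ne_zero y)
      (differentiableAt_const _)]
    simp [VectorCalculus.divergence]
  have hbΨ : ∀ y, ‖g y • e‖ ≤ Cg := fun y => by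
    rw [norm_smul, he, mul_one]; exact hCg y
  have hdbΨ : ∀ y, |VectorCalculus.divergence (fun y => g y • e) y| ≤ Cd := fun y => by
    rw [hdivΨ]
    calc |⟪e, gradient g y⟫| ≤ ‖e‖ * ‖gradient g y‖ := abs_real_inner_le_norm _ _
      _ ≤ Cd := by rw [he, one_mul]; exact hCd y
  have e1 := hgrad (fun y => g y • e) (max Cg Cd) hΨ (fun y => (hbΨ y).trans (le_max_left _ _))
    (fun y => (hdbΨ y).trans (le_max_right _ _))
  -- integration by parts for the smooth `v`
  have hγΨ : ContDiff ℝ 1 (fun y => gaussWeight y • (g y • e)) :=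
    (contDiff_gaussWeight.of_le (mod_cast le_top)).smul hΨ
  have hibp := integral_mul_divergence_add_eq_zero_right (u := fun y => gaussWeight y • (g y • e)) hv hγΨ
    hΨc.smul_left
  have hdivγ : ∀ y, VectorCalculus.divergence (fun y => gaussWeight y • (g y • e)) y =
      gaussWeight y * (VectorCalculus.divergence (fun y => g y • e) y - ⟪g y • e, y⟫ / 2) := by
    intro y
    rw [divergence_smul_apply (u := fun y => g y • e) ((contDiff_gaussWeight (n := 1)).differentiable one_ne_zero y)
      (hΨ.differentiable one_ne_zero y), gradient_gaussWeight, real_inner_smul_right]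
    ring
  have e2 : ∫ y, v y * VectorCalculus.divergence (fun y => gaussWeight y • (g y • e)) y =
      ∫ y, gaussWeight y * (f y * (VectorCalculus.divergence (fun y => g y • e) y - ⟪g y • e, y⟫ / 2)) := by
    refine integral_congr_ae ?_
    filter_upwards [hfv] with y hy
    rw [hdivγ, hy]; ring
  have e3 : ∫ y, ⟪gaussWeight y • (g y • e), gradient v y⟫ = ∫ y, gaussWeight y * ⟪gradient v y, g y • e⟫ :=
    integral_congr_ae (Eventually.of_forall fun y => by
      dsimp only; rw [real_inner_smul_left, real_inner_comm])
  rw [e2, e3] at hibp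
  have e4 : ∫ y, gaussWeight y * ⟪gradient v y, g y • e⟫ = ∫ y, gaussWeight y * ⟪G y, g y • e⟫ := by
    rw [e1]; linarith
  have i1 : Integrable (fun y => gaussWeight y * ⟪gradient v y, g y • e⟫) :=
    (continuous_gaussWeight.mul (hgvc.inner hΨ.continuous)).integrable_of_hasCompactSupport
      ((hasCompactSupport_of_eq_zero hΨc fun y hy => by
        rw [image_eq_zero_of_notMem_tsupport hy, inner_zero_right]).mul_left)
  have i2 : Integrable (fun y => gaussWeight y * ⟪G y, g y • e⟫) := by
    have : Integrable (fun y => ⟪gaussWeight y • G y, g y • e⟫) := by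
      refine (hγG.norm.mul_const Cg).mono' (hγG.aestronglyMeasurable.inner hΨ.continuous.aestronglyMeasurable)
        (Eventually.of_forall fun y => ?_)
      exact (norm_inner_le_norm _ _).trans (mul_le_mul_of_nonneg_left (hbΨ y) (norm_nonneg _))
    refine this.congr (Eventually.of_forall fun y => ?_)
    dsimp only; rw [real_inner_smul_left]
  have e5 : ∫ y, g y • (gaussWeight y * ⟪gradient v y - G y, e⟫) =
      ∫ y, gaussWeight y * ⟪gradient v y, g y • e⟫ - gaussWeight y * ⟪G y, g y • e⟫ := by
    refine integral_congr_ae (Eventually.of_forall fun y => ?_)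
    simp only [smul_eq_mul, inner_sub_left, real_inner_smul_right]
    ring
  rw [e5, integral_sub i1 i2, e4, sub_self]

/-- **The weak `γ`-gradient of a `C¹` function is its gradient.** If `f = v` a.e. with `v ∈ C¹`
and `G` satisfies the weak-gradient identity for `f`, then `∇v = G` a.e. [folklore] -/
theorem gradient_ae_eq_of_weakGradient {v f : E → ℝ} {G : E → E} (hv : ContDiff ℝ 1 v)
    (hfv : f =ᵐ[volume] v) (hG : MemLp G 2 (gaussMeasure (E := E)))
    (hgrad : ∀ (Ψ : E → E) (C : ℝ), ContDiff ℝ 1 Ψ → (∀ y, ‖Ψ y‖ ≤ C) →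
      (∀ y, |VectorCalculus.divergence Ψ y| ≤ C) →
        ∫ y, gaussWeight y * ⟪G y, Ψ y⟫ =
          -∫ y, gaussWeight y * (f y * (VectorCalculus.divergence Ψ y - ⟪Ψ y, y⟫ / 2))) :
    gradient v =ᵐ[volume] G := by
  haveI : CompleteSpace E := FiniteDimensional.complete ℝ E
  set b := stdOrthonormalBasis ℝ E with hb
  have hgvc : Continuous (gradient v) := continuous_gradient_of_contDiff hv
  have hγG := integrable_gaussWeight_smul_of_memLp hG
  have hcoord : ∀ i, ∀ᵐ y ∂(volume : Measure E), ⟪gradient v y - G y, b i⟫ = 0 := by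
    intro i
    have hFi : LocallyIntegrable (fun y => gaussWeight y * ⟪gradient v y - G y, b i⟫) volume := by
      have h1 : Integrable (fun y => ⟪gaussWeight y • G y, b i⟫) := hγG.inner_const (b i)
      have h2 : LocallyIntegrable (fun y => gaussWeight y * ⟪gradient v y, b i⟫) volume :=
        (continuous_gaussWeight.mul (hgvc.inner continuous_const)).locallyIntegrable
      have e : (fun y => gaussWeight y * ⟪gradient v y - G y, b i⟫) =
          (fun y => gaussWeight y * ⟪gradient v y, b i⟫) - fun y => ⟪gaussWeight y • G y, b i⟫ := by
        funext y
        simp only [Pi.sub_apply, inner_sub_left, real_inner_smul_left]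
        ring
      rw [e]
      exact h2.sub h1.locallyIntegrable
    have hz := ae_eq_zero_of_integral_contDiff_smul_eq_zero hFi fun g hg hgc =>
      integral_smul_gaussWeight_mul_inner_sub_eq_zero hv hfv hG hgrad (b.orthonormal.1 i) hg hgc
    filter_upwards [hz] with y hy
    rcases mul_eq_zero.1 hy with h0 | h0
    · exact absurd h0 (gaussWeight_pos y).ne'
    · exact h0
  have hall := ae_all_iff.2 hcoord
  filter_upwards [hall] with y hy
  have : gradient v y - G y = 0 := by
    rw [← b.sum_repr' (gradient v y - G y)]
    simp [real_inner_comm, hy]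
  exact sub_eq_zero.1 this

/-! ### The smooth solution -/

/-- **A smooth nonzero solution with finite Gaussian energy.** Under the drift hypotheses there
is `v ∈ C^∞(E)`, not identically zero, with `v, ∇v ∈ L²(γ)` and
`Δ(γv) + div(γv (½y + U)) = 0` pointwise — i.e. `w = γ v` is a classical solution of `L*w = 0`,
`L* = −Δ − (U + ½y)·∇ − d/2` (Pineau–Vicol 2026, (5.1)–(5.2): existence part of Prop. 5.1, here on
the whole space directly, by Lax–Milgram + Rellich + Fredholm + Hörmander instead of the paper's
Krein–Rutman eigenpairs on balls, Lemmas 5.3–5.5). [cite: PineauVicol2026, Prop. 5.1 / (5.2)] -/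
theorem DriftHyp.exists_smooth_solution {U : E → E} {C₀ : ℝ} (h : DriftHyp U C₀) :
    ∃ v : E → ℝ, ContDiff ℝ ∞ v ∧ MemLp v 2 (gaussMeasure (E := E)) ∧
      MemLp (gradient v) 2 (gaussMeasure (E := E)) ∧ (∃ y, v y ≠ 0) ∧
      ∀ y, (Δ (fun z => gaussWeight z * v z)) y +
        VectorCalculus.divergence (fun z => (gaussWeight z * v z) • ((1 / 2 : ℝ) • z + U z)) y = 0 := by
  obtain ⟨f, G, hf, hG, hf0, hgrad, hweak⟩ := h.exists_weak_solution_fun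
  have hdist := h.integral_mul_transpose_eq_zero hf hgrad hweak
  have hu : LocallyIntegrable (fun y => gaussWeight y * f y) volume :=
    (integrable_gaussWeight_mul_of_memLp hf).locallyIntegrable
  obtain ⟨w, hw, huw⟩ := h.exists_contDiff_ae_eq hu hdist
  set v : E → ℝ := fun y => w y / gaussWeight y with hv
  have hvs : ContDiff ℝ ∞ v := hw.div contDiff_gaussWeight fun y => (gaussWeight_pos y).ne'
  have hwv : ∀ y, gaussWeight y * v y = w y := fun y => by
    simp only [hv]
    field_simp [(gaussWeight_pos y).ne']
  have hfv : f =ᵐ[volume] v := by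
    filter_upwards [huw] with y hy
    simp only [hv]
    rw [← hy]
    field_simp [(gaussWeight_pos y).ne']
  have hv2 : MemLp v 2 (gaussMeasure (E := E)) := hf.ae_eq (gaussMeasure_absolutelyContinuous.ae_le hfv)
  -- classical equation for `w = γ v`
  have hXs : ContDiff ℝ ∞ (fun y : E => (1 / 2 : ℝ) • y + U y) := (contDiff_id.const_smul (1 / 2 : ℝ)).add h.contDiff
  have hdistw : ∀ φ : E → ℝ, ContDiff ℝ ∞ φ → HasCompactSupport φ →
      ∫ y, w y * ((Δ φ) y - fderiv ℝ φ y ((1 / 2 : ℝ) • y + U y)) = 0 := by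
    intro φ hφ hφc
    rw [← hdist φ hφ hφc]
    refine integral_congr_ae ?_
    filter_upwards [huw] with y hy
    rw [hy]
  have hcl := laplacian_add_divergence_eq_zero_of_distributional hw hXs hdistw
  have hw_eq : w = fun z => gaussWeight z * v z := funext fun z => (hwv z).symm
  -- gradient
  have hgv := gradient_ae_eq_of_weakGradient (hvs.of_le (by norm_cast)) hfv hG hgrad
  have hG2 : MemLp (gradient v) 2 (gaussMeasure (E := E)) :=
    hG.ae_eq (gaussMeasure_absolutelyContinuous.ae_le hgv.symm)
  -- nonzero
  have hne : ∃ y, v y ≠ 0 := by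
    by_contra hall
    push Not at hall
    apply hf0
    filter_upwards [hfv] with y hy
    rw [hy, hall y, Pi.zero_apply]
  refine ⟨v, hvs, hv2, hG2, hne, fun y => ?_⟩
  have := hcl y
  rw [hw_eq] at this
  exact this

/-! ## F5: the sign of the smooth solution -/

/-! ### Chain and product rules -/

omit [FiniteDimensional ℝ E] [MeasurableSpace E] [BorelSpace E] in
/-- `D(ψ ∘ v)(x) e = ψ'(v x) · Dv(x) e`. [folklore] -/
theorem fderiv_comp_apply_of_deriv {ψ : ℝ → ℝ} {v : E → ℝ} {x : E} (hψ : DifferentiableAt ℝ ψ (v x))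
    (hv : DifferentiableAt ℝ v x) (e : E) :
    fderiv ℝ (ψ ∘ v) x e = deriv ψ (v x) * fderiv ℝ v x e := by
  rw [(hψ.hasDerivAt.comp_hasFDerivAt x hv.hasFDerivAt).fderiv]
  simp [smul_eq_mul]

omit [MeasurableSpace E] [BorelSpace E] in
/-- `∇(ψ ∘ v) = ψ'(v) ∇v`. [folklore] -/
theorem gradient_comp_of_deriv {ψ : ℝ → ℝ} {v : E → ℝ} {x : E} (hψ : DifferentiableAt ℝ ψ (v x))
    (hv : DifferentiableAt ℝ v x) :
    gradient (ψ ∘ v) x = deriv ψ (v x) • gradient v x := by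
  haveI : CompleteSpace E := FiniteDimensional.complete ℝ E
  simp only [gradient]
  rw [(hψ.hasDerivAt.comp_hasFDerivAt x hv.hasFDerivAt).fderiv, map_smul]

omit [MeasurableSpace E] [BorelSpace E] in
/-- `∇(f g) = f ∇g + g ∇f`. [folklore] -/
theorem gradient_mul_apply {f g : E → ℝ} {x : E} (hf : DifferentiableAt ℝ f x) (hg : DifferentiableAt ℝ g x) :
    gradient (fun y => f y * g y) x = f x • gradient g x + g x • gradient f x := by
  haveI : CompleteSpace E := FiniteDimensional.complete ℝ E
  simp only [gradient]
  rw [fderiv_fun_mul hf hg, map_add, map_smul, map_smul]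

omit [MeasurableSpace E] [BorelSpace E] in
/-- `C²` gives a `C¹` derivative. [folklore] -/
theorem contDiff_one_deriv_of_contDiff_two {ψ : ℝ → ℝ} (hψ : ContDiff ℝ 2 ψ) : ContDiff ℝ 1 (deriv ψ) := by
  have h : ContDiff ℝ (1 + 1) ψ := hψ
  exact (contDiff_succ_iff_deriv.1 h).2.2

omit [MeasurableSpace E] [BorelSpace E] in
/-- **Chain rule for the Laplacian**: `Δ(ψ ∘ v) = ψ'(v) Δv + ψ''(v) |∇v|²`. [folklore] -/
theorem laplacian_comp_eq {ψ : ℝ → ℝ} {v : E → ℝ} (hψ : ContDiff ℝ 2 ψ) (hv : ContDiff ℝ 2 v) (x : E) :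
    (Δ (ψ ∘ v)) x = deriv ψ (v x) * (Δ v) x + deriv (deriv ψ) (v x) * ‖gradient v x‖ ^ 2 := by
  haveI : CompleteSpace E := FiniteDimensional.complete ℝ E
  set b := stdOrthonormalBasis ℝ E with hb
  have hψd : Differentiable ℝ ψ := hψ.differentiable (by norm_num)
  have hψ1 : ContDiff ℝ 1 (deriv ψ) := contDiff_one_deriv_of_contDiff_two hψ
  have hψ'd : Differentiable ℝ (deriv ψ) := hψ1.differentiable one_ne_zero
  have hv1 : ContDiff ℝ 1 v := hv.of_le (by norm_num)
  have hvd : Differentiable ℝ v := hv1.differentiable one_ne_zero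
  have hvi : ∀ e, ContDiff ℝ 1 fun y => fderiv ℝ v y e := fun e =>
    (hv.fderiv_right (m := 1) le_rfl).clm_apply contDiff_const
  rw [laplacian_eq_sum_fderiv_fderiv b (hψ.comp hv) x, laplacian_eq_sum_fderiv_fderiv b hv x,
    ← b.sum_sq_inner_left (gradient v x), Finset.mul_sum, Finset.mul_sum, ← Finset.sum_add_distrib]
  refine Finset.sum_congr rfl fun i _ => ?_
  have h1 : (fun y => fderiv ℝ (ψ ∘ v) y (b i)) = fun y => deriv ψ (v y) * fderiv ℝ v y (b i) :=
    funext fun y => fderiv_comp_apply_of_deriv (hψd (v y)) (hvd y) (b i)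
  rw [h1]
  have hd1 : DifferentiableAt ℝ (fun y => deriv ψ (v y)) x := (hψ'd (v x)).comp x (hvd x)
  have hd2 : DifferentiableAt ℝ (fun y => fderiv ℝ v y (b i)) x := (hvi (b i)).differentiable one_ne_zero x
  rw [fderiv_fun_mul hd1 hd2]
  simp only [add_apply, FunLike.coe_smul, Pi.smul_apply, smul_eq_mul]
  have h2 : fderiv ℝ (fun y => deriv ψ (v y)) x (b i) = deriv (deriv ψ) (v x) * fderiv ℝ v x (b i) :=
    fderiv_comp_apply_of_deriv (ψ := deriv ψ) (hψ'd (v x)) (hvd x) (b i)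
  rw [h2, inner_gradient_left]
  ring

/-! ### The operator `N g = Δ(γg) + div(γ g X₀)` on compositions -/

/-- The operator `N g = Δ(γ g) + div(γ g X₀)` (`= −L*(γg)` for `X₀ = ½y + U`, `∇·U = 0`, cf.
Pineau–Vicol 2026, Remark 5.2: "`L*w = 0` may be rewritten as `Δw + ∇·((U + ½y)w) = 0`").
[cite: PineauVicol2026, Remark 5.2] -/
def adjN (X₀ : E → E) (g : E → ℝ) (y : E) : ℝ :=
  (Δ (fun z => gaussWeight z * g z)) y + VectorCalculus.divergence (fun z => (gaussWeight z * g z) • X₀ z) y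

omit [MeasurableSpace E] [BorelSpace E] in
/-- Expansion of `N(ψ ∘ v)` by the product and chain rules. [folklore] -/
theorem adjN_comp_expand {X₀ : E → E} {ψ : ℝ → ℝ} {v : E → ℝ} (hψ : ContDiff ℝ 2 ψ)
    (hv : ContDiff ℝ 2 v) (hX₀ : ContDiff ℝ 1 X₀) (y : E) :
    adjN X₀ (ψ ∘ v) y =
      gaussWeight y * (deriv ψ (v y) * (Δ v) y + deriv (deriv ψ) (v y) * ‖gradient v y‖ ^ 2)
      + ψ (v y) * (Δ (gaussWeight : E → ℝ)) y
      + 2 * (deriv ψ (v y) * ∑ i, fderiv ℝ gaussWeight y (stdOrthonormalBasis ℝ E i) *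
          fderiv ℝ v y (stdOrthonormalBasis ℝ E i))
      + gaussWeight y * ψ (v y) * VectorCalculus.divergence X₀ y
      + ψ (v y) * ⟪X₀ y, gradient gaussWeight y⟫
      + gaussWeight y * deriv ψ (v y) * ⟪X₀ y, gradient v y⟫ := by
  set b := stdOrthonormalBasis ℝ E with hb
  have hγ2 : ContDiff ℝ 2 (gaussWeight : E → ℝ) := contDiff_gaussWeight
  have hψd : Differentiable ℝ ψ := hψ.differentiable (by norm_num)
  have hvd : Differentiable ℝ v := (hv.of_le (by norm_num)).differentiable one_ne_zero
  have hcomp : ContDiff ℝ 2 (ψ ∘ v) := hψ.comp hv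
  have hγd : Differentiable ℝ (gaussWeight : E → ℝ) := (contDiff_gaussWeight (n := 1)).differentiable one_ne_zero
  unfold adjN
  rw [laplacian_mul_eq b hγ2 hcomp y, laplacian_comp_eq hψ hv y]
  have hsum : ∑ i, fderiv ℝ gaussWeight y (b i) * fderiv ℝ (ψ ∘ v) y (b i) =
      deriv ψ (v y) * ∑ i, fderiv ℝ gaussWeight y (b i) * fderiv ℝ v y (b i) := by
    rw [Finset.mul_sum]
    refine Finset.sum_congr rfl fun i _ => ?_
    rw [fderiv_comp_apply_of_deriv (hψd (v y)) (hvd y)]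
    ring
  rw [hsum]
  have hθd : DifferentiableAt ℝ (fun z => gaussWeight z * (ψ ∘ v) z) y :=
    (hγd y).mul ((hψd (v y)).comp y (hvd y))
  rw [divergence_smul_apply hθd (hX₀.differentiable one_ne_zero y),
    gradient_mul_apply (hγd y) ((hψd (v y)).comp y (hvd y)), gradient_comp_of_deriv (hψd (v y)) (hvd y)]
  simp only [Function.comp_apply, inner_add_right, real_inner_smul_right]
  ring

omit [MeasurableSpace E] [BorelSpace E] in
/-- **The composition identity**:
`N(ψ ∘ v) = ψ'(v) N(v) + (ψ(v) − vψ'(v)) N(1) + γ ψ''(v) |∇v|²`. [folklore] -/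
theorem adjN_comp_eq {X₀ : E → E} {ψ : ℝ → ℝ} {v : E → ℝ} (hψ : ContDiff ℝ 2 ψ)
    (hv : ContDiff ℝ 2 v) (hX₀ : ContDiff ℝ 1 X₀) (y : E) :
    adjN X₀ (ψ ∘ v) y = deriv ψ (v y) * adjN X₀ v y +
      (ψ (v y) - v y * deriv ψ (v y)) * adjN X₀ (fun _ => 1) y +
      gaussWeight y * deriv (deriv ψ) (v y) * ‖gradient v y‖ ^ 2 := by
  have e1 := adjN_comp_expand hψ hv hX₀ y
  have e2 := adjN_comp_expand (ψ := fun t : ℝ => t) contDiff_id hv hX₀ y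
  have e3 := adjN_comp_expand (ψ := fun _ : ℝ => (1 : ℝ)) contDiff_const hv hX₀ y
  have c2 : ((fun t : ℝ => t) ∘ v) = v := rfl
  have c3 : ((fun _ : ℝ => (1 : ℝ)) ∘ v) = fun _ => 1 := rfl
  rw [c2] at e2
  rw [c3] at e3
  simp only [deriv_id'', deriv_const'] at e2 e3
  rw [e1, e2, e3]
  ring

/-! ### The regularised absolute value `ψ_δ(t) = √(t² + δ²)` -/

/-- `ψ_δ(t) = √(t² + δ²)`, a smooth convex approximation of `|t|`. [folklore] -/
def absApprox (δ t : ℝ) : ℝ := Real.sqrt (t ^ 2 + δ ^ 2)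

section AbsApprox

variable {δ : ℝ} (hδ : 0 < δ)
include hδ

omit [NormedAddCommGroup E] [InnerProductSpace ℝ E] [FiniteDimensional ℝ E] [MeasurableSpace E] [BorelSpace E]

/-- `t² + δ² > 0`. [folklore] -/
theorem absApprox_arg_pos (t : ℝ) : 0 < t ^ 2 + δ ^ 2 := by positivity

/-- `ψ_δ > 0`. [folklore] -/
theorem absApprox_pos (t : ℝ) : 0 < absApprox δ t := Real.sqrt_pos.2 (absApprox_arg_pos hδ t)

/-- `ψ_δ² = t² + δ²`. [folklore] -/
theorem absApprox_sq (t : ℝ) : absApprox δ t ^ 2 = t ^ 2 + δ ^ 2 :=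
  Real.sq_sqrt (absApprox_arg_pos hδ t).le

/-- `δ ≤ ψ_δ`. [folklore] -/
theorem le_absApprox (t : ℝ) : δ ≤ absApprox δ t := by
  rw [absApprox, Real.le_sqrt hδ.le (absApprox_arg_pos hδ t).le]
  nlinarith [sq_nonneg t]

omit hδ in
/-- `|t| ≤ ψ_δ(t)`. [folklore] -/
theorem abs_le_absApprox (t : ℝ) : |t| ≤ absApprox δ t :=
  Real.abs_le_sqrt (by nlinarith [sq_nonneg δ])

/-- `ψ_δ(t) ≤ |t| + δ`. [folklore] -/
theorem absApprox_le (t : ℝ) : absApprox δ t ≤ |t| + δ := by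
  rw [absApprox, Real.sqrt_le_left (by positivity)]
  nlinarith [abs_nonneg t, sq_abs t]

/-- `ψ_δ` is smooth. [folklore] -/
theorem contDiff_absApprox {n : ℕ∞} : ContDiff ℝ n (absApprox δ) := by
  unfold absApprox
  exact ((contDiff_id.pow 2).add contDiff_const).sqrt fun t => (absApprox_arg_pos hδ t).ne'

/-- `ψ_δ'(t) = t/ψ_δ(t)`. [folklore] -/
theorem hasDerivAt_absApprox (t : ℝ) : HasDerivAt (absApprox δ) (t / absApprox δ t) t := by
  have h : HasDerivAt (fun t : ℝ => t ^ 2 + δ ^ 2) (2 * t) t := by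
    simpa using ((hasDerivAt_id t).pow 2).add_const (δ ^ 2)
  have := h.sqrt (absApprox_arg_pos hδ t).ne'
  unfold absApprox
  convert this using 1
  rw [mul_div_mul_left _ _ (two_ne_zero)]

/-- `ψ_δ' = t/ψ_δ` as functions. [folklore] -/
theorem deriv_absApprox : deriv (absApprox δ) = fun t => t / absApprox δ t :=
  funext fun t => (hasDerivAt_absApprox hδ t).deriv

/-- `ψ_δ''(t) = δ²/ψ_δ(t)³`. [folklore] -/
theorem hasDerivAt_deriv_absApprox (t : ℝ) :
    HasDerivAt (fun t => t / absApprox δ t) (δ ^ 2 / absApprox δ t ^ 3) t := by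
  have hs := absApprox_pos hδ t
  have hsq := absApprox_sq hδ t
  have h := (hasDerivAt_id' t).div (hasDerivAt_absApprox hδ t) hs.ne'
  have e : (1 * absApprox δ t - t * (t / absApprox δ t)) / absApprox δ t ^ 2 = δ ^ 2 / absApprox δ t ^ 3 := by
    field_simp
    nlinarith [hsq]
  rw [e] at h
  exact h

/-- `ψ_δ'' = δ²/ψ_δ³` as functions. [folklore] -/
theorem deriv_deriv_absApprox : deriv (deriv (absApprox δ)) = fun t => δ ^ 2 / absApprox δ t ^ 3 := by
  rw [deriv_absApprox hδ]
  exact funext fun t => (hasDerivAt_deriv_absApprox hδ t).deriv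

/-- `|ψ_δ'| ≤ 1`. [folklore] -/
theorem abs_deriv_absApprox_le (t : ℝ) : |t / absApprox δ t| ≤ 1 := by
  rw [abs_div, abs_of_pos (absApprox_pos hδ t), div_le_one (absApprox_pos hδ t)]
  exact abs_le_absApprox t

/-- `0 ≤ ψ_δ''`. [folklore] -/
theorem deriv2_absApprox_nonneg (t : ℝ) : 0 ≤ δ ^ 2 / absApprox δ t ^ 3 := by
  have := absApprox_pos hδ t
  positivity

/-- `ψ_δ'' ≤ 1/δ`. [folklore] -/
theorem deriv2_absApprox_le (t : ℝ) : δ ^ 2 / absApprox δ t ^ 3 ≤ 1 / δ := by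
  have hs := absApprox_pos hδ t
  have hle := le_absApprox hδ t
  rw [div_le_div_iff₀ (by positivity) hδ]
  have : δ ^ 3 ≤ absApprox δ t ^ 3 := pow_le_pow_left₀ hδ.le hle 3
  nlinarith

/-- `ψ_δ(t) − t ψ_δ'(t) = δ²/ψ_δ(t)`. [folklore] -/
theorem absApprox_sub_mul_deriv (t : ℝ) : absApprox δ t - t * (t / absApprox δ t) = δ ^ 2 / absApprox δ t := by
  have hs := absApprox_pos hδ t
  have hsq := absApprox_sq hδ t
  field_simp
  nlinarith [hsq]

/-- `0 ≤ ψ_δ(t) − t ψ_δ'(t) ≤ δ`. [folklore] -/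
theorem absApprox_sub_mul_deriv_mem (t : ℝ) :
    0 ≤ absApprox δ t - t * (t / absApprox δ t) ∧ absApprox δ t - t * (t / absApprox δ t) ≤ δ := by
  rw [absApprox_sub_mul_deriv hδ]
  have hs := absApprox_pos hδ t
  refine ⟨by positivity, ?_⟩
  rw [div_le_iff₀ hs]
  nlinarith [le_absApprox hδ t]

end AbsApprox

omit [NormedAddCommGroup E] [InnerProductSpace ℝ E] [FiniteDimensional ℝ E] [MeasurableSpace E] [BorelSpace E] in
/-- `ψ_{1/(n+1)}(t) → |t|`. [folklore] -/
theorem tendsto_absApprox (t : ℝ) : Tendsto (fun n : ℕ => absApprox (1 / ((n : ℝ) + 1)) t) atTop (𝓝 |t|) := by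
  have hc : Continuous fun δ : ℝ => absApprox δ t := by
    unfold absApprox
    exact (continuous_const.add (continuous_pow 2)).sqrt
  have h0 : absApprox 0 t = |t| := by simp [absApprox, Real.sqrt_sq_eq_abs]
  rw [← h0]
  exact (hc.tendsto 0).comp tendsto_one_div_add_atTop_nhds_zero_nat

/-! ### Integrals of divergences of integrable fields -/

/-- **`∫ div F = 0`** for a `C¹` field with `F` and `div F` integrable (cut-offs `χ_R`,
`∫ χ_R div F = −∫ ⟪F, ∇χ_R⟫ = O(1/R)`, dominated convergence). [folklore] -/
theorem integral_divergence_eq_zero_of_integrable {F : E → E} (hF : ContDiff ℝ 1 F) (hi : Integrable F)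
    (hd : Integrable (fun y => VectorCalculus.divergence F y)) :
    ∫ y, VectorCalculus.divergence F y = 0 := by
  obtain ⟨C, hC0, hC⟩ := exists_norm_fderiv_cutoff_le (E := E)
  -- the cut-off identities
  have hibp : ∀ n : ℕ, ∫ y, cutoff ((n : ℝ) + 1) y * VectorCalculus.divergence F y =
      -∫ y, ⟪F y, gradient (cutoff ((n : ℝ) + 1)) y⟫ := by
    intro n
    have h := integral_mul_divergence_add_eq_zero_left (contDiff_cutoff (n := 1) ((n : ℝ) + 1)) hF
      (hasCompactSupport_cutoff (R := (n : ℝ) + 1) (by positivity))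
    linarith
  -- the right-hand sides tend to zero
  have h1 : Tendsto (fun n : ℕ => -∫ y, ⟪F y, gradient (cutoff ((n : ℝ) + 1)) y⟫) atTop (𝓝 0) := by
    have hb : ∀ n : ℕ, |-(∫ y, ⟪F y, gradient (cutoff ((n : ℝ) + 1)) y⟫)| ≤ C / ((n : ℝ) + 1) * ∫ y, ‖F y‖ := by
      intro n
      have hn : (0 : ℝ) < n + 1 := by positivity
      rw [abs_neg, ← Real.norm_eq_abs, ← integral_const_mul]
      refine (norm_integral_le_integral_norm _).trans (integral_mono_of_nonneg
        (Eventually.of_forall fun y => norm_nonneg _) (hi.norm.const_mul _) (Eventually.of_forall fun y => ?_))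
      calc ‖⟪F y, gradient (cutoff ((n : ℝ) + 1)) y⟫‖ ≤ ‖F y‖ * ‖gradient (cutoff ((n : ℝ) + 1)) y‖ :=
            norm_inner_le_norm _ _
        _ ≤ ‖F y‖ * (C / ((n : ℝ) + 1)) := by
            refine mul_le_mul_of_nonneg_left ?_ (norm_nonneg _)
            rw [norm_gradient_eq_norm_fderiv]; exact hC _ hn y
        _ = C / ((n : ℝ) + 1) * ‖F y‖ := mul_comm _ _
    have hlim : Tendsto (fun n : ℕ => C / ((n : ℝ) + 1) * ∫ y, ‖F y‖) atTop (𝓝 0) := by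
      have ht : Tendsto (fun n : ℕ => C / ((n : ℝ) + 1)) atTop (𝓝 0) :=
        tendsto_const_nhds.div_atTop (tendsto_natCast_atTop_atTop.atTop_add tendsto_const_nhds)
      simpa using ht.mul_const (∫ y, ‖F y‖)
    exact squeeze_zero_norm (fun n => by rw [Real.norm_eq_abs]; exact hb n) hlim
  -- the left-hand sides tend to `∫ div F`
  have h2 : Tendsto (fun n : ℕ => ∫ y, cutoff ((n : ℝ) + 1) y * VectorCalculus.divergence F y) atTop
      (𝓝 (∫ y, VectorCalculus.divergence F y)) := by
    refine tendsto_integral_of_dominated_convergence (fun y => ‖VectorCalculus.divergence F y‖)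
      (fun n => ((contDiff_cutoff (n := 0) _).continuous.mul
        (continuous_divergence (hF.continuous_fderiv one_ne_zero))).aestronglyMeasurable)
      hd.norm (fun n => Eventually.of_forall fun y => ?_) (Eventually.of_forall fun y => ?_)
    · rw [norm_mul, Real.norm_eq_abs]
      exact mul_le_of_le_one_left (norm_nonneg _) (abs_cutoff_le_one _ _)
    · simpa using (tendsto_cutoff_natCast_add_one y).mul_const (VectorCalculus.divergence F y)
  have h3 : Tendsto (fun n : ℕ => ∫ y, cutoff ((n : ℝ) + 1) y * VectorCalculus.divergence F y) atTop (𝓝 0) := by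
    simp only [hibp]; exact h1
  exact tendsto_nhds_unique h2 h3

/-! ### `N(1)`, the divergence form of `N`, and the vanishing of `∫ N(ψ_δ ∘ v)` -/

omit [MeasurableSpace E] [BorelSpace E] in
/-- `Δγ = −½dγ + ¼|y|²γ`. [folklore] -/
theorem laplacian_gaussWeight (y : E) :
    (Δ (gaussWeight : E → ℝ)) y = gaussWeight y * (‖y‖ ^ 2 / 4 - Module.finrank ℝ E / 2) := by
  rw [← divergence_gradient contDiff_gaussWeight]
  have e : gradient (gaussWeight : E → ℝ) = fun z => (-(1 / 2 : ℝ) * gaussWeight z) • z :=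
    funext gradient_gaussWeight
  rw [e, divergence_smul_apply (u := fun z : E => z)
    ((((contDiff_gaussWeight (n := 1)).differentiable one_ne_zero).const_mul _) y) differentiableAt_id]
  have hdiv : VectorCalculus.divergence (fun z : E => z) y = Module.finrank ℝ E := by
    rw [VectorCalculus.divergence, fderiv_fun_id, ContinuousLinearMap.coe_id, LinearMap.trace_id]
  have hgrad : gradient (fun z : E => -(1 / 2 : ℝ) * gaussWeight z) y = (-(1 / 2 : ℝ)) • gradient gaussWeight y := by
    have := gradient_const_smul' (-(1 / 2 : ℝ)) ((contDiff_gaussWeight (n := 1)).differentiable one_ne_zero (E := E))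
    exact congrFun this y
  rw [hdiv, hgrad, gradient_gaussWeight, smul_smul, real_inner_smul_right, real_inner_self_eq_norm_sq]
  ring

omit [MeasurableSpace E] [BorelSpace E] in
/-- `div(½y + U) = d/2 + div U`. [folklore] -/
theorem divergence_half_add {U : E → E} (hU : Differentiable ℝ U) (y : E) :
    VectorCalculus.divergence (fun z : E => (1 / 2 : ℝ) • z + U z) y =
      Module.finrank ℝ E / 2 + VectorCalculus.divergence U y := by
  rw [divergence_add_apply (u := fun z : E => (1 / 2 : ℝ) • z) ((differentiableAt_id).const_smul _) (hU y)]
  congr 1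
  have e : fderiv ℝ (fun z : E => (1 / 2 : ℝ) • z) y = (1 / 2 : ℝ) • ContinuousLinearMap.id ℝ E := by
    have : (fun z : E => (1 / 2 : ℝ) • z) = ((1 / 2 : ℝ) • ContinuousLinearMap.id ℝ E : E →L[ℝ] E) := by
      funext z; simp
    rw [this, ContinuousLinearMap.fderiv]
  rw [VectorCalculus.divergence, e]
  simp [LinearMap.trace_id]
  ring

omit [MeasurableSpace E] [BorelSpace E] in
/-- **`N(1) = γ (div U − ½⟪U, y⟫)`** for `X₀ = ½y + U`. [folklore] -/
theorem adjN_one_eq {U : E → E} (hU : ContDiff ℝ 1 U) (y : E) :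
    adjN (fun z : E => (1 / 2 : ℝ) • z + U z) (fun _ => 1) y =
      gaussWeight y * (VectorCalculus.divergence U y - ⟪U y, y⟫ / 2) := by
  have hUd := hU.differentiable one_ne_zero
  have hγd : Differentiable ℝ (gaussWeight : E → ℝ) := (contDiff_gaussWeight (n := 1)).differentiable one_ne_zero
  unfold adjN
  simp only [mul_one]
  rw [laplacian_gaussWeight, divergence_smul_apply (u := fun z : E => (1 / 2 : ℝ) • z + U z) (hγd y)
      (((differentiableAt_id).const_smul _).add (hUd y)),
    divergence_half_add hUd, gradient_gaussWeight, inner_smul_right, inner_add_left, real_inner_smul_left,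
    real_inner_self_eq_norm_sq]
  ring

omit [MeasurableSpace E] [BorelSpace E] in
/-- **Divergence form**: `N g = div(∇(γg) + γ g X₀)`. [folklore] -/
theorem adjN_eq_divergence {X₀ : E → E} {g : E → ℝ} (hg : ContDiff ℝ 2 g) (hX₀ : ContDiff ℝ 1 X₀) (y : E) :
    adjN X₀ g y = VectorCalculus.divergence
      (fun z => gradient (fun w => gaussWeight w * g w) z + (gaussWeight z * g z) • X₀ z) y := by
  have hγg : ContDiff ℝ 2 (fun w => gaussWeight w * g w) := contDiff_gaussWeight.mul hg
  have h1 : DifferentiableAt ℝ (gradient fun w => gaussWeight w * g w) y :=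
    (contDiff_gradient (n := 1) hγg).differentiable one_ne_zero y
  have h2 : DifferentiableAt ℝ (fun z => (gaussWeight z * g z) • X₀ z) y :=
    ((hγg.differentiable (by norm_num)) y).smul (hX₀.differentiable one_ne_zero y)
  rw [divergence_add_apply h1 h2, divergence_gradient hγg, adjN]

omit [MeasurableSpace E] [BorelSpace E] in
/-- The field whose divergence is `N(ψ ∘ v)`, for `X₀ = ½y + U`:
`∇(γ ψ(v)) + γ ψ(v) X₀ = γ (ψ'(v) ∇v + ψ(v) U)` (`∇γ + γ X₀ = γ U`). [folklore] -/
theorem gradient_add_smul_eq {U : E → E} {ψ : ℝ → ℝ} {v : E → ℝ} (hψ : Differentiable ℝ ψ)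
    (hv : Differentiable ℝ v) (y : E) :
    gradient (fun w => gaussWeight w * (ψ ∘ v) w) y + (gaussWeight y * (ψ ∘ v) y) • ((1 / 2 : ℝ) • y + U y) =
      gaussWeight y • (deriv ψ (v y) • gradient v y + ψ (v y) • U y) := by
  have hγd : Differentiable ℝ (gaussWeight : E → ℝ) := (contDiff_gaussWeight (n := 1)).differentiable one_ne_zero
  rw [gradient_mul_apply (hγd y) ((hψ (v y)).comp y (hv y)), gradient_comp_of_deriv (hψ (v y)) (hv y),
    gradient_gaussWeight]
  simp only [Function.comp_apply, smul_add, smul_smul]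
  module

/-! ### The energy bound and the distributional equation for `|v|` -/

section Sign

variable {U : E → E} {C₀ : ℝ}

/-- `γ |∇v|²` is integrable when `∇v ∈ L²(γ)`. [folklore] -/
theorem integrable_gaussWeight_mul_norm_sq_of_memLp {G : E → E} (hG : MemLp G 2 (gaussMeasure (E := E))) :
    Integrable (fun y => gaussWeight y * ‖G y‖ ^ 2) := by
  have h := (memLp_two_iff_integrable_sq_norm hG.1).1 hG
  rw [integrable_gaussMeasure_iff] at h
  simpa only [smul_eq_mul] using h

/-- **The energy bound.** For a smooth solution `v` of `N v = 0` with `v, ∇v ∈ L²(γ)` and every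
`δ > 0`: `∫ γ ψ_δ''(v) |∇v|² ≤ δ · (C₀/2) ∫ γ` — from `∫ N(ψ_δ ∘ v) = 0` and the composition
identity (the level sets of `v` carry no gradient energy; this replaces Krein–Rutman positivity).
[folklore] -/
theorem DriftHyp.integral_gaussWeight_mul_deriv2_le (h : DriftHyp U C₀) {v : E → ℝ} (hv : ContDiff ℝ ∞ v)
    (hv2 : MemLp v 2 (gaussMeasure (E := E))) (hG2 : MemLp (gradient v) 2 (gaussMeasure (E := E)))
    (hN : ∀ y, adjN (fun z : E => (1 / 2 : ℝ) • z + U z) v y = 0) {δ : ℝ} (hδ : 0 < δ) :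
    ∫ y, gaussWeight y * (δ ^ 2 / absApprox δ (v y) ^ 3) * ‖gradient v y‖ ^ 2 ≤
      δ * (C₀ / 2 * ∫ y : E, gaussWeight y) := by
  haveI : CompleteSpace E := FiniteDimensional.complete ℝ E
  set X₀ : E → E := fun z => (1 / 2 : ℝ) • z + U z with hX₀
  have hX₀1 : ContDiff ℝ 1 X₀ := ((contDiff_id.const_smul (1 / 2 : ℝ)).add h.contDiff).of_le (mod_cast le_top)
  set ψ : ℝ → ℝ := absApprox δ with hψdef
  have hψ : ContDiff ℝ 2 ψ := contDiff_absApprox hδ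
  have hψs : ContDiff ℝ ∞ ψ := contDiff_absApprox hδ
  have hψd : Differentiable ℝ ψ := hψ.differentiable (by norm_num)
  have hv2c : ContDiff ℝ 2 v := hv.of_le (by norm_cast)
  have hvd : Differentiable ℝ v := (hv.of_le (by norm_cast)).differentiable one_ne_zero
  have hC₀ := h.nonneg
  -- the field and its divergence
  set F : E → E := fun z => gradient (fun w => gaussWeight w * (ψ ∘ v) w) z + (gaussWeight z * (ψ ∘ v) z) • X₀ z
    with hFdef
  have hFeq : ∀ y, F y = gaussWeight y • (deriv ψ (v y) • gradient v y + ψ (v y) • U y) := fun y =>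
    gradient_add_smul_eq hψd hvd y
  have hγψv : ContDiff ℝ ∞ (fun w => gaussWeight w * (ψ ∘ v) w) := contDiff_gaussWeight.mul (hψs.comp hv)
  have hF1 : ContDiff ℝ 1 F :=
    (contDiff_gradient (n := 1) (hγψv.of_le (by norm_cast))).add ((hγψv.of_le (by norm_cast)).smul hX₀1)
  have hdivF : ∀ y, VectorCalculus.divergence F y =
      (ψ (v y) - v y * (v y / ψ (v y))) * (gaussWeight y * (VectorCalculus.divergence U y - ⟪U y, y⟫ / 2)) +
        gaussWeight y * (δ ^ 2 / ψ (v y) ^ 3) * ‖gradient v y‖ ^ 2 := by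
    intro y
    rw [hFdef, ← adjN_eq_divergence (hψ.comp hv2c) hX₀1, adjN_comp_eq hψ hv2c hX₀1, hN y, mul_zero, zero_add,
      adjN_one_eq h.contDiff_one, hψdef, deriv_deriv_absApprox hδ, deriv_absApprox hδ]
  -- integrability of `F`
  have hγv : Integrable (fun y => gaussWeight y * v y) := integrable_gaussWeight_mul_of_memLp hv2
  have hγG : Integrable (fun y => gaussWeight y • gradient v y) := integrable_gaussWeight_smul_of_memLp hG2
  have hFi : Integrable F := by
    refine Integrable.mono' (g := fun y => ‖gaussWeight y • gradient v y‖ + C₀ * ‖gaussWeight y * v y‖ +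
        δ * C₀ * gaussWeight y) ((hγG.norm.add (hγv.norm.const_mul C₀)).add (integrable_gaussWeight.const_mul _))
      hF1.continuous.aestronglyMeasurable (Eventually.of_forall fun y => ?_)
    rw [hFeq y]
    have hγ := (gaussWeight_pos y).le
    have h1 : ‖deriv ψ (v y) • gradient v y‖ ≤ ‖gradient v y‖ := by
      rw [norm_smul, hψdef, deriv_absApprox hδ, Real.norm_eq_abs]
      exact mul_le_of_le_one_left (norm_nonneg _) (abs_deriv_absApprox_le hδ _)
    have h2 : ‖ψ (v y) • U y‖ ≤ (|v y| + δ) * C₀ := by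
      rw [norm_smul, Real.norm_eq_abs, abs_of_pos (absApprox_pos hδ _)]
      exact mul_le_mul (absApprox_le hδ _) (h.norm_le y) (norm_nonneg _) (by positivity)
    calc ‖gaussWeight y • (deriv ψ (v y) • gradient v y + ψ (v y) • U y)‖
        = gaussWeight y * ‖deriv ψ (v y) • gradient v y + ψ (v y) • U y‖ := by
          rw [norm_smul, Real.norm_of_nonneg hγ]
      _ ≤ gaussWeight y * (‖gradient v y‖ + (|v y| + δ) * C₀) :=
          mul_le_mul_of_nonneg_left ((norm_add_le _ _).trans (add_le_add h1 h2)) hγ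
      _ = ‖gaussWeight y • gradient v y‖ + C₀ * ‖gaussWeight y * v y‖ + δ * C₀ * gaussWeight y := by
          rw [norm_smul, Real.norm_of_nonneg hγ, norm_mul, Real.norm_of_nonneg hγ, Real.norm_eq_abs]
          ring
  -- integrability of `div F`
  have hN1 : ∀ y, gaussWeight y * (VectorCalculus.divergence U y - ⟪U y, y⟫ / 2) = -(gaussWeight y * (⟪U y, y⟫ / 2)) := by
    intro y; rw [h.div_eq_zero y]; ring
  have hA : Integrable (fun y => (ψ (v y) - v y * (v y / ψ (v y))) *
      (gaussWeight y * (VectorCalculus.divergence U y - ⟪U y, y⟫ / 2))) := by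
    refine Integrable.mono' (g := fun y => δ * (C₀ / 2 * gaussWeight y)) ((integrable_gaussWeight.const_mul _).const_mul _)
      ?_ (Eventually.of_forall fun y => ?_)
    · exact (((hψ.continuous.comp hv.continuous).sub (hv.continuous.mul (hv.continuous.div
        (hψ.continuous.comp hv.continuous) fun y => (absApprox_pos hδ _).ne'))).mul
        (continuous_gaussWeight.mul ((continuous_divergence (h.contDiff_one.continuous_fderiv one_ne_zero)).sub
          ((h.continuous.inner continuous_id).div_const 2)))).aestronglyMeasurable
    · rw [hN1, norm_mul, norm_neg, norm_mul, Real.norm_of_nonneg (gaussWeight_pos y).le, Real.norm_eq_abs,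
        Real.norm_eq_abs]
      obtain ⟨h0, h1⟩ := absApprox_sub_mul_deriv_mem hδ (v y)
      rw [abs_of_nonneg h0]
      have hin : |⟪U y, y⟫ / 2| ≤ C₀ / 2 := by
        rw [abs_div, abs_two]; exact div_le_div_of_nonneg_right (h.abs_inner_le y) (by norm_num)
      have := mul_le_mul h1 (mul_le_mul_of_nonneg_left hin (gaussWeight_pos y).le)
        (mul_nonneg (gaussWeight_pos y).le (abs_nonneg _)) hδ.le
      calc _ ≤ δ * (gaussWeight y * (C₀ / 2)) := this
        _ = δ * (C₀ / 2 * gaussWeight y) := by ring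
  have hB : Integrable (fun y => gaussWeight y * (δ ^ 2 / ψ (v y) ^ 3) * ‖gradient v y‖ ^ 2) := by
    refine Integrable.mono' (g := fun y => (1 / δ) * (gaussWeight y * ‖gradient v y‖ ^ 2))
      ((integrable_gaussWeight_mul_norm_sq_of_memLp hG2).const_mul _) ?_ (Eventually.of_forall fun y => ?_)
    · exact ((continuous_gaussWeight.mul ((continuous_const.div ((hψ.continuous.comp hv.continuous).pow 3)
        fun y => pow_ne_zero 3 (absApprox_pos hδ _).ne'))).mul
        ((continuous_gradient_of_contDiff (hv.of_le (by norm_cast))).norm.pow 2)).aestronglyMeasurable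
    · have hγ := (gaussWeight_pos y).le
      have hnn : 0 ≤ gaussWeight y * (δ ^ 2 / ψ (v y) ^ 3) * ‖gradient v y‖ ^ 2 :=
        mul_nonneg (mul_nonneg hγ (deriv2_absApprox_nonneg hδ _)) (sq_nonneg _)
      rw [Real.norm_of_nonneg hnn]
      have := deriv2_absApprox_le hδ (v y)
      have h3 : gaussWeight y * (δ ^ 2 / ψ (v y) ^ 3) ≤ gaussWeight y * (1 / δ) := mul_le_mul_of_nonneg_left this hγ
      calc _ ≤ gaussWeight y * (1 / δ) * ‖gradient v y‖ ^ 2 := mul_le_mul_of_nonneg_right h3 (sq_nonneg _)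
        _ = (1 / δ) * (gaussWeight y * ‖gradient v y‖ ^ 2) := by ring
  have hdivi : Integrable (fun y => VectorCalculus.divergence F y) := by
    have := hA.add hB
    refine this.congr (Eventually.of_forall fun y => ?_)
    simp only [Pi.add_apply]
    exact (hdivF y).symm
  -- the vanishing integral
  have h0 := integral_divergence_eq_zero_of_integrable hF1 hFi hdivi
  have hsplit : ∫ y, VectorCalculus.divergence F y =
      (∫ y, (ψ (v y) - v y * (v y / ψ (v y))) * (gaussWeight y * (VectorCalculus.divergence U y - ⟪U y, y⟫ / 2))) +
        ∫ y, gaussWeight y * (δ ^ 2 / ψ (v y) ^ 3) * ‖gradient v y‖ ^ 2 := by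
    rw [← integral_add hA hB]
    exact integral_congr_ae (Eventually.of_forall hdivF)
  rw [hsplit] at h0
  -- bound the first integral
  have hAle : |∫ y, (ψ (v y) - v y * (v y / ψ (v y))) *
      (gaussWeight y * (VectorCalculus.divergence U y - ⟪U y, y⟫ / 2))| ≤ δ * (C₀ / 2 * ∫ y : E, gaussWeight y) := by
    rw [← integral_const_mul, ← integral_const_mul, ← Real.norm_eq_abs]
    refine (norm_integral_le_integral_norm _).trans (integral_mono_of_nonneg (Eventually.of_forall fun y => norm_nonneg _)
      ((integrable_gaussWeight.const_mul _).const_mul _) (Eventually.of_forall fun y => ?_))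
    dsimp only
    rw [hN1, norm_mul, norm_neg, norm_mul, Real.norm_of_nonneg (gaussWeight_pos y).le, Real.norm_eq_abs, Real.norm_eq_abs]
    obtain ⟨h0', h1⟩ := absApprox_sub_mul_deriv_mem hδ (v y)
    rw [abs_of_nonneg h0']
    have hin : |⟪U y, y⟫ / 2| ≤ C₀ / 2 := by
      rw [abs_div, abs_two]; exact div_le_div_of_nonneg_right (h.abs_inner_le y) (by norm_num)
    have := mul_le_mul h1 (mul_le_mul_of_nonneg_left hin (gaussWeight_pos y).le)
      (mul_nonneg (gaussWeight_pos y).le (abs_nonneg _)) hδ.le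
    calc _ ≤ δ * (gaussWeight y * (C₀ / 2)) := this
      _ = δ * (C₀ / 2 * gaussWeight y) := by ring
  have := neg_le_abs (∫ y, (ψ (v y) - v y * (v y / ψ (v y))) *
      (gaussWeight y * (VectorCalculus.divergence U y - ⟪U y, y⟫ / 2)))
  linarith

/-- **Test-function bound.** With the same data, for a test function `φ` with `|φ| ≤ M`:
`|∫ γ ψ_δ(v) (Δφ − Dφ[½y + U])| ≤ M · δ C₀ ∫γ`. [folklore] -/
theorem DriftHyp.abs_integral_absApprox_transpose_le (h : DriftHyp U C₀) {v : E → ℝ} (hv : ContDiff ℝ ∞ v)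
    (hv2 : MemLp v 2 (gaussMeasure (E := E))) (hG2 : MemLp (gradient v) 2 (gaussMeasure (E := E)))
    (hN : ∀ y, adjN (fun z : E => (1 / 2 : ℝ) • z + U z) v y = 0) {δ : ℝ} (hδ : 0 < δ)
    {φ : E → ℝ} (hφ : ContDiff ℝ ∞ φ) (hφc : HasCompactSupport φ) {M : ℝ} (hM : ∀ y, |φ y| ≤ M) :
    |∫ y, gaussWeight y * absApprox δ (v y) * ((Δ φ) y - fderiv ℝ φ y ((1 / 2 : ℝ) • y + U y))| ≤
      M * (2 * (δ * (C₀ / 2 * ∫ y : E, gaussWeight y))) := by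
  set X₀ : E → E := fun z => (1 / 2 : ℝ) • z + U z with hX₀
  have hX₀1 : ContDiff ℝ 1 X₀ := ((contDiff_id.const_smul (1 / 2 : ℝ)).add h.contDiff).of_le (mod_cast le_top)
  have hψ : ContDiff ℝ 2 (absApprox δ) := contDiff_absApprox hδ
  have hψs : ContDiff ℝ ∞ (absApprox δ) := contDiff_absApprox hδ
  have hv2c : ContDiff ℝ 2 v := hv.of_le (by norm_cast)
  have hM0 : 0 ≤ M := (abs_nonneg _).trans (hM 0)
  have hC₀ := h.nonneg
  have hw2 : ContDiff ℝ 2 (fun z => gaussWeight z * (absApprox δ ∘ v) z) := contDiff_gaussWeight.mul (hψ.comp hv2c)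
  -- transpose onto `N(ψ ∘ v)`
  have ht := integral_mul_transpose_eq (X₀ := X₀) hw2 hX₀1 hφ hφc
  have hid : ∀ y, (Δ (fun z => gaussWeight z * (absApprox δ ∘ v) z)) y +
      VectorCalculus.divergence (fun z => (gaussWeight z * (absApprox δ ∘ v) z) • X₀ z) y =
      (absApprox δ (v y) - v y * (v y / absApprox δ (v y))) *
        (gaussWeight y * (VectorCalculus.divergence U y - ⟪U y, y⟫ / 2)) +
        gaussWeight y * (δ ^ 2 / absApprox δ (v y) ^ 3) * ‖gradient v y‖ ^ 2 := by
    intro y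
    have e := adjN_comp_eq (X₀ := X₀) hψ hv2c hX₀1 y
    rw [hN y, mul_zero, zero_add, adjN_one_eq h.contDiff_one, deriv_deriv_absApprox hδ, deriv_absApprox hδ] at e
    exact e
  have heq : ∫ y, gaussWeight y * absApprox δ (v y) * ((Δ φ) y - fderiv ℝ φ y (X₀ y)) =
      ∫ y, ((absApprox δ (v y) - v y * (v y / absApprox δ (v y))) *
        (gaussWeight y * (VectorCalculus.divergence U y - ⟪U y, y⟫ / 2)) * φ y +
        gaussWeight y * (δ ^ 2 / absApprox δ (v y) ^ 3) * ‖gradient v y‖ ^ 2 * φ y) := by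
    have e0 : ∫ y, gaussWeight y * absApprox δ (v y) * ((Δ φ) y - fderiv ℝ φ y (X₀ y)) =
        ∫ y, (gaussWeight y * (absApprox δ ∘ v) y) * ((Δ φ) y - fderiv ℝ φ y (X₀ y)) :=
      integral_congr_ae (Eventually.of_forall fun y => rfl)
    rw [e0, ht]
    refine integral_congr_ae (Eventually.of_forall fun y => ?_)
    dsimp only
    rw [hid y]
    ring
  -- the two bounds
  have hN1 : ∀ y, gaussWeight y * (VectorCalculus.divergence U y - ⟪U y, y⟫ / 2) = -(gaussWeight y * (⟪U y, y⟫ / 2)) := by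
    intro y; rw [h.div_eq_zero y]; ring
  have hptA : ∀ y, ‖(absApprox δ (v y) - v y * (v y / absApprox δ (v y))) *
      (gaussWeight y * (VectorCalculus.divergence U y - ⟪U y, y⟫ / 2)) * φ y‖ ≤ M * (δ * (C₀ / 2 * gaussWeight y)) := by
    intro y
    rw [hN1, norm_mul, norm_mul, norm_neg, norm_mul, Real.norm_of_nonneg (gaussWeight_pos y).le, Real.norm_eq_abs,
      Real.norm_eq_abs, Real.norm_eq_abs]
    obtain ⟨h0', h1⟩ := absApprox_sub_mul_deriv_mem hδ (v y)
    rw [abs_of_nonneg h0']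
    have hin : |⟪U y, y⟫ / 2| ≤ C₀ / 2 := by
      rw [abs_div, abs_two]; exact div_le_div_of_nonneg_right (h.abs_inner_le y) (by norm_num)
    have h2 := mul_le_mul h1 (mul_le_mul_of_nonneg_left hin (gaussWeight_pos y).le)
      (mul_nonneg (gaussWeight_pos y).le (abs_nonneg _)) hδ.le
    have h3 := mul_le_mul h2 (hM y) (abs_nonneg _)
      (mul_nonneg hδ.le (mul_nonneg (gaussWeight_pos y).le (by positivity)))
    calc _ ≤ δ * (gaussWeight y * (C₀ / 2)) * M := h3
      _ = M * (δ * (C₀ / 2 * gaussWeight y)) := by ring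
  have hptB : ∀ y, ‖gaussWeight y * (δ ^ 2 / absApprox δ (v y) ^ 3) * ‖gradient v y‖ ^ 2 * φ y‖ ≤
      M * (gaussWeight y * (δ ^ 2 / absApprox δ (v y) ^ 3) * ‖gradient v y‖ ^ 2) := by
    intro y
    have hnn : 0 ≤ gaussWeight y * (δ ^ 2 / absApprox δ (v y) ^ 3) * ‖gradient v y‖ ^ 2 :=
      mul_nonneg (mul_nonneg (gaussWeight_pos y).le (deriv2_absApprox_nonneg hδ _)) (sq_nonneg _)
    rw [norm_mul, Real.norm_of_nonneg hnn, Real.norm_eq_abs, mul_comm]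
    exact mul_le_mul_of_nonneg_right (hM y) hnn
  -- integrability
  have hcontA0 : Continuous fun y => (absApprox δ (v y) - v y * (v y / absApprox δ (v y))) *
      (gaussWeight y * (VectorCalculus.divergence U y - ⟪U y, y⟫ / 2)) :=
    (((hψ.continuous.comp hv.continuous).sub (hv.continuous.mul (hv.continuous.div
        (hψ.continuous.comp hv.continuous) fun y => (absApprox_pos hδ _).ne'))).mul
        (continuous_gaussWeight.mul ((continuous_divergence (h.contDiff_one.continuous_fderiv one_ne_zero)).sub
          ((h.continuous.inner continuous_id).div_const 2))))
  have hcontA : Continuous fun y => (absApprox δ (v y) - v y * (v y / absApprox δ (v y))) *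
      (gaussWeight y * (VectorCalculus.divergence U y - ⟪U y, y⟫ / 2)) * φ y := hcontA0.mul hφ.continuous
  have hcontB0 : Continuous fun y => gaussWeight y * (δ ^ 2 / absApprox δ (v y) ^ 3) * ‖gradient v y‖ ^ 2 :=
    (continuous_gaussWeight.mul ((continuous_const.div ((hψ.continuous.comp hv.continuous).pow 3)
        fun y => pow_ne_zero 3 (absApprox_pos hδ _).ne'))).mul
        ((continuous_gradient_of_contDiff (hv.of_le (by norm_cast))).norm.pow 2)
  have hcontB : Continuous fun y => gaussWeight y * (δ ^ 2 / absApprox δ (v y) ^ 3) * ‖gradient v y‖ ^ 2 * φ y :=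
    hcontB0.mul hφ.continuous
  have hiA : Integrable (fun y => (absApprox δ (v y) - v y * (v y / absApprox δ (v y))) *
      (gaussWeight y * (VectorCalculus.divergence U y - ⟪U y, y⟫ / 2)) * φ y) :=
    Integrable.mono' (((integrable_gaussWeight.const_mul _).const_mul _).const_mul _) hcontA.aestronglyMeasurable
      (Eventually.of_forall hptA)
  have hB0 : Integrable (fun y => gaussWeight y * (δ ^ 2 / absApprox δ (v y) ^ 3) * ‖gradient v y‖ ^ 2) := by
    refine Integrable.mono' (g := fun y => (1 / δ) * (gaussWeight y * ‖gradient v y‖ ^ 2))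
      ((integrable_gaussWeight_mul_norm_sq_of_memLp hG2).const_mul _) hcontB0.aestronglyMeasurable
      (Eventually.of_forall fun y => ?_)
    have hγ := (gaussWeight_pos y).le
    have hnn : 0 ≤ gaussWeight y * (δ ^ 2 / absApprox δ (v y) ^ 3) * ‖gradient v y‖ ^ 2 :=
      mul_nonneg (mul_nonneg hγ (deriv2_absApprox_nonneg hδ _)) (sq_nonneg _)
    rw [Real.norm_of_nonneg hnn]
    have h3 : gaussWeight y * (δ ^ 2 / absApprox δ (v y) ^ 3) ≤ gaussWeight y * (1 / δ) :=
      mul_le_mul_of_nonneg_left (deriv2_absApprox_le hδ (v y)) hγ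
    calc _ ≤ gaussWeight y * (1 / δ) * ‖gradient v y‖ ^ 2 := mul_le_mul_of_nonneg_right h3 (sq_nonneg _)
      _ = (1 / δ) * (gaussWeight y * ‖gradient v y‖ ^ 2) := by ring
  have hiB : Integrable (fun y => gaussWeight y * (δ ^ 2 / absApprox δ (v y) ^ 3) * ‖gradient v y‖ ^ 2 * φ y) :=
    Integrable.mono' (hB0.const_mul M) hcontB.aestronglyMeasurable (Eventually.of_forall hptB)
  have henergy := h.integral_gaussWeight_mul_deriv2_le hv hv2 hG2 hN hδ
  rw [heq, integral_add hiA hiB]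
  have bA : |∫ y, (absApprox δ (v y) - v y * (v y / absApprox δ (v y))) *
      (gaussWeight y * (VectorCalculus.divergence U y - ⟪U y, y⟫ / 2)) * φ y| ≤ M * (δ * (C₀ / 2 * ∫ y : E, gaussWeight y)) := by
    rw [← integral_const_mul, ← integral_const_mul, ← integral_const_mul, ← Real.norm_eq_abs]
    exact (norm_integral_le_integral_norm _).trans (integral_mono_of_nonneg (Eventually.of_forall fun y => norm_nonneg _)
      (((integrable_gaussWeight.const_mul _).const_mul _).const_mul _) (Eventually.of_forall hptA))
  have bB : |∫ y, gaussWeight y * (δ ^ 2 / absApprox δ (v y) ^ 3) * ‖gradient v y‖ ^ 2 * φ y| ≤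
      M * (δ * (C₀ / 2 * ∫ y : E, gaussWeight y)) := by
    have h1 : |∫ y, gaussWeight y * (δ ^ 2 / absApprox δ (v y) ^ 3) * ‖gradient v y‖ ^ 2 * φ y| ≤
        M * ∫ y, gaussWeight y * (δ ^ 2 / absApprox δ (v y) ^ 3) * ‖gradient v y‖ ^ 2 := by
      rw [← integral_const_mul, ← Real.norm_eq_abs]
      exact (norm_integral_le_integral_norm _).trans (integral_mono_of_nonneg (Eventually.of_forall fun y => norm_nonneg _)
        (hB0.const_mul M) (Eventually.of_forall hptB))
    exact h1.trans (mul_le_mul_of_nonneg_left henergy hM0)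
  calc _ ≤ |∫ y, (absApprox δ (v y) - v y * (v y / absApprox δ (v y))) *
        (gaussWeight y * (VectorCalculus.divergence U y - ⟪U y, y⟫ / 2)) * φ y| +
        |∫ y, gaussWeight y * (δ ^ 2 / absApprox δ (v y) ^ 3) * ‖gradient v y‖ ^ 2 * φ y| := abs_add_le _ _
    _ ≤ M * (2 * (δ * (C₀ / 2 * ∫ y : E, gaussWeight y))) := by linarith

/-- **`|v|` solves the equation distributionally**: `∫ γ|v| (Δφ − Dφ[½y + U]) = 0` for every test
function (let `δ → 0` in the test-function bound; dominated convergence). [folklore] -/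
theorem DriftHyp.integral_gaussWeight_mul_abs_transpose_eq_zero (h : DriftHyp U C₀) {v : E → ℝ}
    (hv : ContDiff ℝ ∞ v) (hv2 : MemLp v 2 (gaussMeasure (E := E))) (hG2 : MemLp (gradient v) 2 (gaussMeasure (E := E)))
    (hN : ∀ y, adjN (fun z : E => (1 / 2 : ℝ) • z + U z) v y = 0)
    {φ : E → ℝ} (hφ : ContDiff ℝ ∞ φ) (hφc : HasCompactSupport φ) :
    ∫ y, gaussWeight y * |v y| * ((Δ φ) y - fderiv ℝ φ y ((1 / 2 : ℝ) • y + U y)) = 0 := by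
  obtain ⟨M, hM⟩ := exists_bound_of_hasCompactSupport hφ.continuous hφc
  have hM' : ∀ y, |φ y| ≤ M := fun y => by rw [← Real.norm_eq_abs]; exact hM y
  -- the multiplier `g = Δφ − Dφ[X₀]` is bounded (continuous, compactly supported)
  set g : E → ℝ := fun y => (Δ φ) y - fderiv ℝ φ y ((1 / 2 : ℝ) • y + U y) with hg
  have hφ2 : ContDiff ℝ 2 φ := hφ.of_le (by norm_cast)
  have hgc : Continuous g := (continuous_laplacian hφ2).sub
    ((hφ.continuous_fderiv (by simp)).clm_apply ((continuous_id.const_smul _).add h.continuous))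
  have hgs : HasCompactSupport g := by
    refine hasCompactSupport_of_eq_zero hφc fun y hy => ?_
    simp only [hg, laplacian_eq_zero_of_notMem_tsupport hy, fderiv_of_notMem_tsupport ℝ hy, zero_apply, sub_zero]
  obtain ⟨K, hK⟩ := exists_bound_of_hasCompactSupport hgc hgs
  -- the sequence
  set a : ℕ → ℝ := fun n => ∫ y, gaussWeight y * absApprox (1 / ((n : ℝ) + 1)) (v y) * g y with ha
  have h1 : Tendsto a atTop (𝓝 0) := by
    have hb : ∀ n : ℕ, |a n| ≤ M * (2 * ((1 / ((n : ℝ) + 1)) * (C₀ / 2 * ∫ y : E, gaussWeight y))) := fun n =>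
      h.abs_integral_absApprox_transpose_le hv hv2 hG2 hN (by positivity) hφ hφc hM'
    have hlim : Tendsto (fun n : ℕ => M * (2 * ((1 / ((n : ℝ) + 1)) * (C₀ / 2 * ∫ y : E, gaussWeight y)))) atTop (𝓝 0) := by
      have ht : Tendsto (fun n : ℕ => (1 : ℝ) / ((n : ℝ) + 1)) atTop (𝓝 0) := tendsto_one_div_add_atTop_nhds_zero_nat
      simpa using ((ht.mul_const (C₀ / 2 * ∫ y : E, gaussWeight y)).const_mul 2).const_mul M
    exact squeeze_zero_norm (fun n => by rw [Real.norm_eq_abs]; exact hb n) hlim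
  have hγv : Integrable (fun y => gaussWeight y * v y) := integrable_gaussWeight_mul_of_memLp hv2
  have h2 : Tendsto a atTop (𝓝 (∫ y, gaussWeight y * |v y| * g y)) := by
    refine tendsto_integral_of_dominated_convergence (fun y => (‖gaussWeight y * v y‖ + gaussWeight y) * K)
      (fun n => ?_) ((hγv.norm.add integrable_gaussWeight).mul_const K) (fun n => Eventually.of_forall fun y => ?_)
      (Eventually.of_forall fun y => ?_)
    · exact ((continuous_gaussWeight.mul ((contDiff_absApprox (n := 0) (by positivity)).continuous.comp hv.continuous)).mul
        hgc).aestronglyMeasurable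
    · have hn : (0 : ℝ) < 1 / ((n : ℝ) + 1) := by positivity
      rw [norm_mul, norm_mul, Real.norm_of_nonneg (gaussWeight_pos y).le, Real.norm_eq_abs,
        abs_of_pos (absApprox_pos hn _), norm_mul, Real.norm_of_nonneg (gaussWeight_pos y).le, Real.norm_eq_abs]
      have hle := absApprox_le hn (v y)
      have hle1 : (1 : ℝ) / ((n : ℝ) + 1) ≤ 1 := by
        rw [div_le_one (by positivity)]; linarith [n.cast_nonneg (α := ℝ)]
      have hγ := (gaussWeight_pos y).le
      calc gaussWeight y * absApprox (1 / ((n : ℝ) + 1)) (v y) * ‖g y‖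
          ≤ gaussWeight y * (|v y| + 1) * K := by
            refine mul_le_mul (mul_le_mul_of_nonneg_left (hle.trans (by linarith)) hγ) (hK y) (norm_nonneg _) ?_
            positivity
        _ = (gaussWeight y * |v y| + gaussWeight y) * K := by ring
    · exact ((tendsto_absApprox (v y)).const_mul (gaussWeight y)).mul_const (g y)
  exact tendsto_nhds_unique h2 h1

/-- `max t 0 = (|t| + t)/2`. [folklore] -/
theorem max_zero_eq_half (t : ℝ) : max t 0 = (|t| + t) / 2 := by
  rcases le_or_gt 0 t with ht | ht
  · rw [max_eq_left ht, abs_of_nonneg ht]; ring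
  · rw [max_eq_right ht.le, abs_of_neg ht]; ring

/-- **The positive part `v⁺` is smooth and is again a classical solution** (`γ v⁺` solves the
equation distributionally, hence is smooth by hypoellipticity; continuity upgrades a.e. to
everywhere). [folklore] -/
theorem DriftHyp.posPart_contDiff (h : DriftHyp U C₀) {v : E → ℝ} (hv : ContDiff ℝ ∞ v)
    (hv2 : MemLp v 2 (gaussMeasure (E := E))) (hG2 : MemLp (gradient v) 2 (gaussMeasure (E := E)))
    (hN : ∀ y, adjN (fun z : E => (1 / 2 : ℝ) • z + U z) v y = 0) :
    ContDiff ℝ ∞ (fun y => max (v y) 0) ∧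
      ∀ y, adjN (fun z : E => (1 / 2 : ℝ) • z + U z) (fun y => max (v y) 0) y = 0 := by
  set X₀ : E → E := fun z => (1 / 2 : ℝ) • z + U z with hX₀
  have hXs : ContDiff ℝ ∞ X₀ := (contDiff_id.const_smul (1 / 2 : ℝ)).add h.contDiff
  have hX₀1 : ContDiff ℝ 1 X₀ := hXs.of_le (mod_cast le_top)
  have hγv2 : ContDiff ℝ 2 (fun z => gaussWeight z * v z) := contDiff_gaussWeight.mul (hv.of_le (by norm_cast))
  have hγv : Integrable (fun y => gaussWeight y * v y) := integrable_gaussWeight_mul_of_memLp hv2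
  -- the distributional equation for `γ v⁺`
  have hdist : ∀ φ : E → ℝ, ContDiff ℝ ∞ φ → HasCompactSupport φ →
      ∫ y, (gaussWeight y * max (v y) 0) * ((Δ φ) y - fderiv ℝ φ y (X₀ y)) = 0 := by
    intro φ hφ hφc
    have habs := h.integral_gaussWeight_mul_abs_transpose_eq_zero hv hv2 hG2 hN hφ hφc
    have hlin : ∫ y, (gaussWeight y * v y) * ((Δ φ) y - fderiv ℝ φ y (X₀ y)) = 0 := by
      rw [integral_mul_transpose_eq (X₀ := X₀) hγv2 hX₀1 hφ hφc]
      have : ∀ y, ((Δ (fun z => gaussWeight z * v z)) y +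
          VectorCalculus.divergence (fun z => (gaussWeight z * v z) • X₀ z) y) * φ y = 0 := fun y => by
        have := hN y
        unfold adjN at this
        rw [this, zero_mul]
      simp [this]
    -- bounded multiplier
    set g : E → ℝ := fun y => (Δ φ) y - fderiv ℝ φ y (X₀ y) with hg
    have hφ2 : ContDiff ℝ 2 φ := hφ.of_le (by norm_cast)
    have hgc : Continuous g := (continuous_laplacian hφ2).sub
      ((hφ.continuous_fderiv (by simp)).clm_apply hXs.continuous)
    have hgs : HasCompactSupport g := by
      refine hasCompactSupport_of_eq_zero hφc fun y hy => ?_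
      simp only [hg, laplacian_eq_zero_of_notMem_tsupport hy, fderiv_of_notMem_tsupport ℝ hy, zero_apply, sub_zero]
    obtain ⟨K, hK⟩ := exists_bound_of_hasCompactSupport hgc hgs
    have i1 : Integrable (fun y => gaussWeight y * |v y| * g y) := by
      have : Integrable (fun y => |gaussWeight y * v y| * g y) := hγv.abs.mul_bdd hgc.aestronglyMeasurable
        (Eventually.of_forall hK)
      refine this.congr (Eventually.of_forall fun y => ?_)
      dsimp only
      rw [abs_mul, abs_of_pos (gaussWeight_pos y)]
    have i2 : Integrable (fun y => gaussWeight y * v y * g y) := hγv.mul_bdd hgc.aestronglyMeasurable (Eventually.of_forall hK)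
    have e : ∫ y, (gaussWeight y * max (v y) 0) * g y =
        ∫ y, (1 / 2 : ℝ) * (gaussWeight y * |v y| * g y + gaussWeight y * v y * g y) := by
      refine integral_congr_ae (Eventually.of_forall fun y => ?_)
      dsimp only
      rw [max_zero_eq_half]; ring
    rw [e, integral_const_mul, integral_add i1 i2, habs, hlin]
    simp
  have hcont : Continuous fun y => gaussWeight y * max (v y) 0 :=
    continuous_gaussWeight.mul (hv.continuous.max continuous_const)
  obtain ⟨w, hw, hae⟩ := h.exists_contDiff_ae_eq hcont.locallyIntegrable hdist
  have heq : (fun y => gaussWeight y * max (v y) 0) = w := (hcont.ae_eq_iff_eq volume hw.continuous).1 hae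
  have hsmooth : ContDiff ℝ ∞ (fun y => max (v y) 0) := by
    have e : (fun y => max (v y) 0) = fun y => w y / gaussWeight y := by
      funext y
      have := congrFun heq y
      rw [← this]
      field_simp [(gaussWeight_pos y).ne']
    rw [e]
    exact hw.div contDiff_gaussWeight fun y => (gaussWeight_pos y).ne'
  have hdistw : ∀ φ : E → ℝ, ContDiff ℝ ∞ φ → HasCompactSupport φ →
      ∫ y, w y * ((Δ φ) y - fderiv ℝ φ y (X₀ y)) = 0 := by
    intro φ hφ hφc
    rw [← heq]
    exact hdist φ hφ hφc
  have hcl := laplacian_add_divergence_eq_zero_of_distributional hw hXs hdistw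
  refine ⟨hsmooth, fun y => ?_⟩
  unfold adjN
  have e1 := hcl y
  rw [← heq] at e1
  exact e1

omit [MeasurableSpace E] [BorelSpace E] in
/-- `N(−g) = −N(g)`. [folklore] -/
theorem adjN_neg {X₀ : E → E} {g : E → ℝ} (hg : ContDiff ℝ 2 g) (hX₀ : ContDiff ℝ 1 X₀) (y : E) :
    adjN X₀ (fun z => -g z) y = -adjN X₀ g y := by
  have e := adjN_comp_eq (ψ := fun t : ℝ => -t) (contDiff_neg) hg hX₀ y
  have c : ((fun t : ℝ => -t) ∘ g) = fun z => -g z := rfl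
  rw [c] at e
  rw [e]
  simp only [deriv_neg', deriv_const']
  ring

omit [MeasurableSpace E] [BorelSpace E] in
/-- **The non-divergence form of `N`** for `X₀ = ½y + U`:
`N g = −γ (−Δg + Dg[½y − U] + (½⟪U,y⟫ − div U) g)` (`= −γ M g`; Pineau–Vicol's
`L*(γ v) = γ M v`). [folklore] -/
theorem adjN_eq_neg_mul {U : E → E} {g : E → ℝ} (hg : ContDiff ℝ 2 g) (hU : ContDiff ℝ 1 U) (y : E) :
    adjN (fun z : E => (1 / 2 : ℝ) • z + U z) g y =
      -(gaussWeight y * (-(Δ g) y + fderiv ℝ g y ((1 / 2 : ℝ) • y - U y) +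
        (⟪U y, y⟫ / 2 - VectorCalculus.divergence U y) * g y)) := by
  haveI : CompleteSpace E := FiniteDimensional.complete ℝ E
  set b := stdOrthonormalBasis ℝ E with hb
  have hX₀1 : ContDiff ℝ 1 (fun z : E => (1 / 2 : ℝ) • z + U z) :=
    ((contDiff_id.const_smul (1 / 2 : ℝ)).add hU)
  have e := adjN_comp_expand (X₀ := fun z : E => (1 / 2 : ℝ) • z + U z) (ψ := fun t : ℝ => t) contDiff_id hg hX₀1 y
  have c : ((fun t : ℝ => t) ∘ g) = g := rfl
  rw [c] at e
  rw [e]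
  have hsum : ∑ i, fderiv ℝ gaussWeight y (b i) * fderiv ℝ g y (b i) = ⟪gradient gaussWeight y, gradient g y⟫ := by
    rw [← b.sum_inner_mul_inner (gradient gaussWeight y) (gradient g y)]
    refine Finset.sum_congr rfl fun i _ => ?_
    rw [← inner_gradient_left, ← inner_gradient_left]
    congr 1
    rw [real_inner_comm]
  simp only [deriv_id'', deriv_const', one_mul, mul_one, zero_mul, add_zero] at hsum ⊢
  rw [hsum, laplacian_gaussWeight, divergence_half_add (hU.differentiable one_ne_zero), gradient_gaussWeight,
    show fderiv ℝ g y ((1 / 2 : ℝ) • y - U y) = ⟪gradient g y, (1 / 2 : ℝ) • y - U y⟫ from inner_gradient_left.symm]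
  simp only [inner_add_left, inner_add_right, inner_sub_right, real_inner_smul_left, real_inner_smul_right,
    real_inner_self_eq_norm_sq, real_inner_comm (gradient g y)]
  ring

end Sign

/-! ### Hopf's minimum principle on Euclidean space: the dichotomy and the positive solution -/

section Euclidean

variable {n : ℕ} {U : EuclideanSpace ℝ (Fin n) → EuclideanSpace ℝ (Fin n)} {C₀ : ℝ}

/-- `Σᵢ D²u(x)[eᵢ, eᵢ] = Δu(x)` in the standard frame of Euclidean space. [folklore] -/
theorem sum_fderiv_fderiv_single_eq_laplacian {u : EuclideanSpace ℝ (Fin n) → ℝ} (hu : ContDiff ℝ 2 u)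
    (x : EuclideanSpace ℝ (Fin n)) :
    ∑ i, fderiv ℝ (fderiv ℝ u) x (EuclideanSpace.single i 1) (EuclideanSpace.single i 1) = (Δ u) x := by
  classical
  rw [laplacian_eq_sum_fderiv_fderiv (EuclideanSpace.basisFun (Fin n) ℝ) hu x]
  refine Finset.sum_congr rfl fun i _ => ?_
  have hd : DifferentiableAt ℝ (fderiv ℝ u) x :=
    ((hu.fderiv_right (m := 1) le_rfl).differentiable one_ne_zero) x
  rw [EuclideanSpace.basisFun_apply, fderiv_clm_apply hd (differentiableAt_const _)]
  simp

/-- `Σᵢ vᵢ Du(x)[eᵢ] = Du(x)[v]`. [folklore] -/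
theorem sum_mul_fderiv_single {u : EuclideanSpace ℝ (Fin n) → ℝ} (x v : EuclideanSpace ℝ (Fin n)) :
    ∑ i, v i * fderiv ℝ u x (EuclideanSpace.single i 1) = fderiv ℝ u x v := by
  classical
  have hv : ∑ i, v i • EuclideanSpace.single i (1 : ℝ) = v := by
    have := (EuclideanSpace.basisFun (Fin n) ℝ).sum_repr v
    simpa [EuclideanSpace.basisFun_apply, EuclideanSpace.basisFun_repr] using this
  conv_rhs => rw [← hv]
  rw [map_sum]
  refine Finset.sum_congr rfl fun i _ => ?_
  rw [map_smul, smul_eq_mul]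

/-- **Hopf's strong minimum principle for nonnegative classical solutions of `N p = 0`**
(`E = ℝⁿ`): a smooth `p ≥ 0` with `N p = 0` vanishing at one point vanishes identically — the
tree's `Literature.Analysis.PDE.hopf_minimumPrinciple` (López-Gómez 2012, Thm. 1.2; Gilbarg–Trudinger Thm. 3.5 —
the minimum principle Pineau–Vicol invoke in the proof of Lemma 5.5, "[27, Theorem 3.5]") for
`𝔏 = −Δ + (½y − U)·∇ + (½⟪U,y⟫)⁺`, `𝔏p = ((½⟪U,y⟫)⁺ − ½⟪U,y⟫) p ≥ 0`. [cite: PineauVicol2026, proof of Lemma 5.5 (strict positivity via [27, Thm. 3.5])] -/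
theorem DriftHyp.eq_zero_of_nonneg_of_apply_eq_zero (h : DriftHyp U C₀) {p : EuclideanSpace ℝ (Fin n) → ℝ}
    (hp : ContDiff ℝ ∞ p) (hp0 : ∀ y, 0 ≤ p y)
    (hNp : ∀ y, adjN (fun z : EuclideanSpace ℝ (Fin n) => (1 / 2 : ℝ) • z + U z) p y = 0)
    {x₀ : EuclideanSpace ℝ (Fin n)} (hx₀ : p x₀ = 0) : ∀ x, p x = 0 := by
  classical
  have hp2 : ContDiff ℝ 2 p := hp.of_le (by norm_cast)
  set bvec : EuclideanSpace ℝ (Fin n) → EuclideanSpace ℝ (Fin n) := fun x => (1 / 2 : ℝ) • x - U x with hbvec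
  have hbc : Continuous bvec := (continuous_id.const_smul (1 / 2 : ℝ)).sub h.continuous
  set cfun : EuclideanSpace ℝ (Fin n) → ℝ := fun x => ⟪U x, x⟫ / 2 with hcfun
  have hcc : Continuous cfun := (h.continuous.inner continuous_id).div_const 2
  -- the pointwise equation `−Δp + Dp[bvec] + c p = 0`
  have hMp : ∀ x, -(Δ p) x + fderiv ℝ p x (bvec x) + cfun x * p x = 0 := by
    intro x
    have e := hNp x
    rw [adjN_eq_neg_mul hp2 h.contDiff_one x, h.div_eq_zero x, sub_zero, neg_eq_zero] at e
    rcases mul_eq_zero.1 e with h0 | h0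
    · exact absurd h0 (gaussWeight_pos x).ne'
    · exact h0
  have key := Literature.Analysis.PDE.hopf_minimumPrinciple (N := n) (Ω := Set.univ) isOpen_univ isPreconnected_univ
    (a := fun _ i j => if i = j then (1 : ℝ) else 0) (b := fun x i => bvec x i) (c := fun x => max (cfun x) 0)
    (u := p) (μ := 1) (m := 0)
    (fun _ _ i j => by by_cases hij : i = j <;> simp [hij, eq_comm]) one_pos
    (fun x _ ξ => by
      rw [one_mul, EuclideanSpace.real_norm_sq_eq]
      refine le_of_eq (Finset.sum_congr rfl fun i _ => ?_)
      simp only [ite_mul, one_mul, zero_mul, Finset.sum_ite_eq, Finset.mem_univ, if_true, sq])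
    ?_ (fun x _ => le_max_right _ _) hp2.contDiffOn ?_ le_rfl (fun x _ => hp0 x) (Set.mem_univ x₀) hx₀
  · exact fun x => key x (Set.mem_univ x)
  · -- bounded coefficients on compact sets
    intro K _ hK
    obtain ⟨Cb, hCb⟩ := hK.exists_bound_of_continuousOn hbc.continuousOn
    obtain ⟨Cc, hCc⟩ := hK.exists_bound_of_continuousOn hcc.continuousOn
    refine ⟨max 1 (max Cb Cc), fun x hx => ⟨fun i j => ?_, fun i => ?_, ?_⟩⟩
    · by_cases hij : i = j <;> simp [hij]
    · calc |bvec x i| ≤ ‖bvec x‖ := by rw [← Real.norm_eq_abs]; exact PiLp.norm_apply_le (bvec x) i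
        _ ≤ Cb := hCb x hx
        _ ≤ max 1 (max Cb Cc) := (le_max_left _ _).trans (le_max_right _ _)
    · have h1 : |max (cfun x) 0| ≤ |cfun x| := by
        rw [abs_of_nonneg (le_max_right _ _)]
        exact max_le (le_abs_self _) (abs_nonneg _)
      calc |max (cfun x) 0| ≤ |cfun x| := h1
        _ = ‖cfun x‖ := (Real.norm_eq_abs _).symm
        _ ≤ Cc := hCc x hx
        _ ≤ max 1 (max Cb Cc) := (le_max_right _ _).trans (le_max_right _ _)
  · -- `𝔏p ≥ 0`
    intro x _
    have hsum2 : ∑ i, ∑ j, (if i = j then (1 : ℝ) else 0) *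
        fderiv ℝ (fderiv ℝ p) x (EuclideanSpace.single i 1) (EuclideanSpace.single j 1) = (Δ p) x := by
      rw [← sum_fderiv_fderiv_single_eq_laplacian hp2 x]
      refine Finset.sum_congr rfl fun i _ => ?_
      simp only [ite_mul, one_mul, zero_mul, Finset.sum_ite_eq, Finset.mem_univ, if_true]
    rw [hsum2, sum_mul_fderiv_single]
    have := hMp x
    have hc : 0 ≤ (max (cfun x) 0 - cfun x) * p x := mul_nonneg (by linarith [le_max_left (cfun x) 0]) (hp0 x)
    nlinarith

omit [MeasurableSpace E] [BorelSpace E] in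
/-- `∇(−v) = −∇v`. [folklore] -/
theorem gradient_fun_neg' {E' : Type*} [NormedAddCommGroup E'] [InnerProductSpace ℝ E'] [CompleteSpace E']
    (v : E' → ℝ) : gradient (fun y => -v y) = fun y => -gradient v y := by
  funext y
  simp only [gradient, fderiv_fun_neg, map_neg]

/-- **Dichotomy**: a smooth finite-energy solution of `N v = 0` is either everywhere positive or
everywhere `≤ 0` (Hopf's minimum principle applied to the smooth solution `v⁺`). [folklore] -/
theorem DriftHyp.pos_or_nonpos (h : DriftHyp U C₀) {v : EuclideanSpace ℝ (Fin n) → ℝ} (hv : ContDiff ℝ ∞ v)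
    (hv2 : MemLp v 2 (gaussMeasure (E := EuclideanSpace ℝ (Fin n))))
    (hG2 : MemLp (gradient v) 2 (gaussMeasure (E := EuclideanSpace ℝ (Fin n))))
    (hN : ∀ y, adjN (fun z : EuclideanSpace ℝ (Fin n) => (1 / 2 : ℝ) • z + U z) v y = 0) :
    (∀ y, 0 < v y) ∨ (∀ y, v y ≤ 0) := by
  by_cases hex : ∃ x₀, v x₀ ≤ 0
  · right
    obtain ⟨x₀, hx₀⟩ := hex
    obtain ⟨hps, hNp⟩ := h.posPart_contDiff hv hv2 hG2 hN
    have hzero := h.eq_zero_of_nonneg_of_apply_eq_zero hps (fun y => le_max_right _ _) hNp (x₀ := x₀)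
      (max_eq_right hx₀)
    intro y
    exact max_eq_right_iff.1 (hzero y)
  · left
    push Not at hex
    exact hex

/-- **Existence of a positive weight** (Pineau–Vicol 2026, Prop. 5.1, existence and strict
positivity of `w = γ v` with `L*w = 0`, here on `ℝⁿ` for any admissible drift): there is
`v ∈ C^∞(ℝⁿ)`, `v > 0` everywhere, `v, ∇v ∈ L²(γ)`, with `Δ(γv) + div(γv(½y + U)) = 0`.
(Gaussian upper/lower bounds (5.3) are the next file.) [cite: PineauVicol2026, Prop. 5.1 ((5.2), w > 0)] -/
theorem DriftHyp.exists_pos_solution (h : DriftHyp U C₀) :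
    ∃ v : EuclideanSpace ℝ (Fin n) → ℝ, ContDiff ℝ ∞ v ∧
      MemLp v 2 (gaussMeasure (E := EuclideanSpace ℝ (Fin n))) ∧
      MemLp (gradient v) 2 (gaussMeasure (E := EuclideanSpace ℝ (Fin n))) ∧ (∀ y, 0 < v y) ∧
      ∀ y, adjN (fun z : EuclideanSpace ℝ (Fin n) => (1 / 2 : ℝ) • z + U z) v y = 0 := by
  obtain ⟨v, hv, hv2, hG2, ⟨y₀, hy₀⟩, hN⟩ := h.exists_smooth_solution
  have hN' : ∀ y, adjN (fun z : EuclideanSpace ℝ (Fin n) => (1 / 2 : ℝ) • z + U z) v y = 0 := hN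
  rcases h.pos_or_nonpos hv hv2 hG2 hN' with hpos | hnonpos
  · exact ⟨v, hv, hv2, hG2, hpos, hN'⟩
  · have hX₀1 : ContDiff ℝ 1 (fun z : EuclideanSpace ℝ (Fin n) => (1 / 2 : ℝ) • z + U z) :=
      (contDiff_id.const_smul (1 / 2 : ℝ)).add h.contDiff_one
    have hnv : ContDiff ℝ ∞ (fun y => -v y) := hv.neg
    have hnv2 : MemLp (fun y => -v y) 2 (gaussMeasure (E := EuclideanSpace ℝ (Fin n))) := hv2.neg
    have hnG2 : MemLp (gradient fun y => -v y) 2 (gaussMeasure (E := EuclideanSpace ℝ (Fin n))) := by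
      rw [gradient_fun_neg']; exact hG2.neg
    have hNn : ∀ y, adjN (fun z : EuclideanSpace ℝ (Fin n) => (1 / 2 : ℝ) • z + U z) (fun y => -v y) y = 0 :=
      fun y => by rw [adjN_neg (hv.of_le (by norm_cast)) hX₀1, hN' y, neg_zero]
    rcases h.pos_or_nonpos hnv hnv2 hnG2 hNn with hpos' | hnonpos'
    · exact ⟨fun y => -v y, hnv, hnv2, hnG2, hpos', hNn⟩
    · exfalso
      have h1 := hnonpos y₀
      have h2 := hnonpos' y₀
      exact hy₀ (by linarith)

end Euclidean

end PineauVicol2026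

end Literature.Analysis.FluidPDE
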